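import Literature.Barriers.FinalStateConjecture.KleinGordonRadialLiouville
import Literature.Analysis.ODE.ParametricSecondOrderData
import Literature.Analysis.ODE.HalfLineShooting
import Literature.Analysis.ODE.WronskianMatching
import Literature.Analysis.ODE.RecessiveSolution
import HarnessLib

/-!
# Real mode solutions of the Klein–Gordon equation on Kerr at the threshold frequency
# `ω₀ = am/(2Mr₊)`: reality, the ground-state transform, shooting in the mass

Topic `Literature/Barriers/FinalStateConjecture` (namespace `Literature.Barriers.FinalStateConjecture`),
continuing `KleinGordonRadialLiouville.lean`. This is the ODE ("Sturm") rendering of §4.2 of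
Shlapentokh-Rothman, Comm. Math. Phys. 329 (2014) (existence of real mode solutions with
`am − 2Mr₊ω = 0`), replacing the variational construction of loc. cit. by shooting in the mass
parameter. Everything is proved:

* `omega0`, `thrP`, `thrPhase0`: the threshold frequency `ω₀` (`am − 2Mr₊ω₀ = 0`, so the horizon
  exponent `β` vanishes), the parameter triple `(ω₀, Λ, σ)` and the horizon value `Φ₀` of the phase;
* **reality** (`im_conj_thrPhase0_mul_radY`): for real `Λ, σ` the horizon-regular solution `y` of
  `KleinGordonRadialLiouville.lean` satisfies `conj Φ₀ · y ∈ ℝ` on `(r₊, ∞)` (the horizon current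
  `im(y'ȳ) = am − 2Mω₀r₊` vanishes, so `W(y, ȳ) = 0`); the real family `thrZ`, `thrZ₁` solving
  `z'' = q z`, `q = thrQ = re Q` (`isSol2_thrZ`), positive near `r₊` (`thrZ_pos_of_near`, uniformly in
  the parameters via `‖u − 1‖ ≤ 2/7`, `norm_horU_sub_one_le`);
* the potential at threshold `V = Δ[(σ − ω₀²)r² − 2Mω₀²r + Λ] − 4M²ω₀²(r − r₊)²` (`thrV_eq`), the
  **ground-state transform** `R = z/√Δ` with flux `Δ R' = W(√Δ, z) → 0` at `r₊`
  (`tendsto_flux_thrR`) and `(ΔR')' = (V/Δ) R`, whence **`V ≥ 0 ⟹ z > 0`** on `(r₊, ∞)`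
  (`thrZ_pos_of_thrV_nonneg`, by `HalfLineShooting.pos_of_flux_tendsto_zero`) with the criterion
  `thrV_nonneg`;
* one-parameter families `μ ↦ (ω₀, Λ(μ), μ²)`: joint continuity in `(μ, t)`
  (`continuousOn_thrZ_family`, from `ParametricSecondOrderData.lean`), uniform positivity near `r₊`,
  uniform far-field bounds `c ≤ q ≤ K` (`exists_thrQ_ge_uniform`), a zero for `σ` slightly above
  `ω₀²` (`exists_zero_thrZ_of_small`, SR Lemma 4.3 as a Sturm window), the **bound state**
  `exists_threshold_boundState` (SR Props. 4.1–4.2 by `HalfLineShooting.exists_boundState_of_sup_oscillation`),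
  the **Sturm comparison** `exists_zero_of_lt` (below the bound state every member has a zero) and
  the escape of zeros to infinity near the bound state (`eventually_thrZ_pos_on_Ioc`).

## References
* Y. Shlapentokh-Rothman, *Exponentially growing finite energy solutions for the Klein–Gordon
  equation on sub-extremal Kerr spacetimes*, Comm. Math. Phys. 329 (2014) 859–891, §4.2
  (Props. 4.1–4.2, Lemma 4.3), §3.2. Key `ShlapentokhRothman2014KleinGordon`.
* P. Hartman, *Ordinary Differential Equations*, SIAM Classics 38 (2002), Ch. XI §6. Key `Hartman2002`.
-/

noncomputable section

open Set Filter Metric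
open scoped Topology ComplexConjugate

namespace Literature.Barriers.FinalStateConjecture

open Literature.Geometry.Lorentzian Literature.Analysis.ODE

/-! ### The threshold frequency `ω₀ = am/(2Mr₊)` -/

section Threshold

variable (M a : ℝ) (m : ℤ)

/-- **The threshold frequency** `ω₀ = am/(2Mr₊)` (`am − 2Mr₊ω₀ = 0`).
[cite: ShlapentokhRothman2014KleinGordon, Thm. 1.2] -/
def omega0 : ℝ := a * m / (2 * M * Kerr.rPlus M a)

/-- The threshold parameter triple `(ω₀, Λ, σ)`. [folklore] -/
def thrP (Λ σ : ℂ) : ℂ × ℂ × ℂ := ((omega0 M a m : ℂ), Λ, σ)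

/-- The horizon value `Φ₀ = Φ(r₊)` of the phase at threshold. [folklore] -/
def thrPhase0 : ℂ := radPhase M a m (omega0 M a m) (Kerr.rPlus M a)

variable {M a m}

/-- `am − 2Mω₀r₊ = 0`. [cite: ShlapentokhRothman2014KleinGordon, Thm. 1.2] -/
theorem am_sub_omega0 (h : Kerr.IsSubextremal M a) : a * m - 2 * M * omega0 M a m * Kerr.rPlus M a = 0 := by
  have hM := h.pos
  have hr := rPlus_pos_of_isSubextremal h
  unfold omega0
  field_simp
  ring

/-- `β(ω₀) = 0`. [folklore] -/
theorem horBeta_omega0 (h : Kerr.IsSubextremal M a) : horBeta M a m (omega0 M a m) = 0 := by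
  have := am_sub_omega0 (m := m) h
  simp only [horBeta]
  exact_mod_cast this

/-- `K(r) = 2Mω₀(r − r₊)` at threshold. [folklore] -/
theorem radK_omega0 (h : Kerr.IsSubextremal M a) (r : ℝ) :
    radK M a m (omega0 M a m) r = ((2 * M * omega0 M a m * (r - Kerr.rPlus M a) : ℝ) : ℂ) := by
  have := am_sub_omega0 (m := m) h
  have e : (a * m : ℝ) = 2 * M * omega0 M a m * Kerr.rPlus M a := by linarith
  simp only [radK, e]
  push_cast
  ring

/-- The threshold triple lies in `horGood`. [folklore] -/
theorem thrP_mem_horGood (h : Kerr.IsSubextremal M a) (Λ σ : ℂ) : thrP M a m Λ σ ∈ horGood M a :=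
  mem_horGood_of_im_nonneg h (by simp [thrP])

/-- Components of the threshold triple. [folklore] -/
@[simp] theorem thrP_fst (Λ σ : ℂ) : (thrP M a m Λ σ).1 = (omega0 M a m : ℂ) := rfl

/-- Components of the threshold triple. [folklore] -/
@[simp] theorem thrP_snd_fst (Λ σ : ℂ) : (thrP M a m Λ σ).2.1 = Λ := rfl

/-- Components of the threshold triple. [folklore] -/
@[simp] theorem thrP_snd_snd (Λ σ : ℂ) : (thrP M a m Λ σ).2.2 = σ := rfl

/-- At threshold the phase exponent is `θ(r) = −(β₋/d) log(r − r₋)` (the `log(r − r₊)` term has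
coefficient `β/d = 0`), hence continuous at `r₊`. [folklore] -/
theorem radTheta_omega0 (h : Kerr.IsSubextremal M a) (r : ℝ) :
    radTheta M a m (omega0 M a m) r =
      -((((a * m : ℝ) : ℂ) - 2 * M * (omega0 M a m : ℂ) * Kerr.rMinus M a) / (horD M a : ℂ) *
        ((Real.log (r - Kerr.rMinus M a) : ℝ) : ℂ)) := by
  rw [radTheta, horBeta_omega0 h, zero_div, zero_mul, zero_sub]

/-- The threshold phase `Φ = exp(iθ)` is continuous at `r₊`. [folklore] -/
theorem continuousAt_radPhase_omega0 (h : Kerr.IsSubextremal M a) :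
    ContinuousAt (radPhase M a m (omega0 M a m)) (Kerr.rPlus M a) := by
  have hd : 0 < Kerr.rPlus M a - Kerr.rMinus M a := sub_pos.2 h.rMinus_lt_rPlus
  have hlog : ContinuousAt (fun r : ℝ ↦ ((Real.log (r - Kerr.rMinus M a) : ℝ) : ℂ)) (Kerr.rPlus M a) := by
    have h1 : ContinuousAt (fun r : ℝ ↦ Real.log (r - Kerr.rMinus M a)) (Kerr.rPlus M a) :=
      (continuousAt_id.sub continuousAt_const).log hd.ne'
    exact Complex.continuous_ofReal.continuousAt.comp h1
  have hθ : ContinuousAt (radTheta M a m (omega0 M a m)) (Kerr.rPlus M a) := by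
    have : radTheta M a m (omega0 M a m) = fun r ↦
        -((((a * m : ℝ) : ℂ) - 2 * M * (omega0 M a m : ℂ) * Kerr.rMinus M a) / (horD M a : ℂ) *
          ((Real.log (r - Kerr.rMinus M a) : ℝ) : ℂ)) := funext (radTheta_omega0 h)
    rw [this]
    exact (continuousAt_const.mul hlog).neg
  exact (Complex.continuous_exp.continuousAt).comp (continuousAt_const.mul hθ)

/-- `‖Φ₀‖ = 1`. [folklore] -/
theorem norm_thrPhase0 : ‖thrPhase0 M a m‖ = 1 := norm_radPhase_of_im_eq_zero (by simp) _

/-- `Φ₀ ≠ 0`. [folklore] -/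
theorem thrPhase0_ne_zero : thrPhase0 M a m ≠ 0 := by
  have := norm_thrPhase0 (M := M) (a := a) (m := m)
  intro h0; rw [h0, norm_zero] at this; exact zero_ne_one this

/-- `Φ₀ conj Φ₀ = 1`. [folklore] -/
theorem thrPhase0_mul_conj : thrPhase0 M a m * conj (thrPhase0 M a m) = 1 := by
  rw [Complex.mul_conj, Complex.normSq_eq_norm_sq, norm_thrPhase0]; simp

/-- `conj Φ₀ · Φ₀ = 1`. [folklore] -/
theorem conj_thrPhase0_mul : conj (thrPhase0 M a m) * thrPhase0 M a m = 1 := by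
  rw [mul_comm]; exact thrPhase0_mul_conj

end Threshold

/-! ### Reality of `conj Φ₀ · y` at threshold -/

section Reality

variable {M a : ℝ} {m : ℤ}

/-- Conjugating a solution pair: `ȳ'' = Q̄ ȳ`. [folklore] -/
theorem isSol2_conj {Q y y' : ℝ → ℂ} {s : Set ℝ} (hy : IsSol2 Q y y' s) :
    IsSol2 (fun t ↦ conj (Q t)) (fun t ↦ conj (y t)) (fun t ↦ conj (y' t)) s := by
  refine ⟨fun t ht ↦ ?_, fun t ht ↦ ?_⟩
  · simpa only [starRingEnd_apply] using (hy.hasDerivAt t ht).star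
  · have h1 := (hy.hasDerivAt_deriv t ht).star
    rw [star_mul'] at h1
    simpa only [starRingEnd_apply] using h1

/-- For a real triple, `radQ` is invariant under conjugation. [folklore] -/
theorem conj_radQ_ofReal (w Λ σ : ℝ) (r : ℝ) :
    conj (radQ M a m ((w : ℂ), (Λ : ℂ), (σ : ℂ)) r) = radQ M a m ((w : ℂ), (Λ : ℂ), (σ : ℂ)) r :=
  Complex.conj_eq_iff_im.2 (im_radQ_ofReal w Λ σ r)

/-- **`u` stays close to `1` near `r₊`, uniformly in the parameters**: for `|r − r₊| ≤ ρ(R)/8`,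
`‖u(r; p) − 1‖ ≤ 2/7` (from `‖cₖ‖ ≤ 2ρ^{−k}`). [folklore] -/
theorem norm_horU_sub_one_le (h : Kerr.IsSubextremal M a) {R : ℝ} (hR : 0 ≤ R) {p : ℂ × ℂ × ℂ}
    (hp : p ∈ horGood M a) (hpR : p ∈ horBoxClosed R) {r : ℝ} (hr : |r - Kerr.rPlus M a| ≤ horRho M a R / 8) :
    ‖horU M a m p r - 1‖ ≤ 2 / 7 := by
  have hρ := horRho_pos h hR
  set x : ℂ := (r : ℂ) - Kerr.rPlus M a with hx
  have hxn : ‖x‖ ≤ horRho M a R / 8 := by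
    rw [hx, ← Complex.ofReal_sub, Complex.norm_real, Real.norm_eq_abs]; exact hr
  have hxlt : ‖x‖ < horRho M a R / 2 := hxn.trans_lt (by linarith)
  have hs := hasSum_horFun h m hR hp hpR hxlt
  have hs1 : HasSum (fun k ↦ horCoeff M a m p (k + 1) * x ^ (k + 1)) (horFun M a m p x - 1) := by
    have := (hasSum_nat_add_iff' 1).2 hs
    simpa using this
  have hq : ‖x‖ * (horRho M a R)⁻¹ ≤ 1 / 8 := by
    rw [← div_eq_mul_inv, div_le_iff₀ hρ]; linarith
  have hq0 : 0 ≤ ‖x‖ * (horRho M a R)⁻¹ := by positivity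
  have hgeom : HasSum (fun k : ℕ ↦ 2 * (1 / 8 : ℝ) * (1 / 8 : ℝ) ^ k) (2 * (1 / 8 : ℝ) * (1 - 1 / 8)⁻¹) :=
    (hasSum_geometric_of_lt_one (by norm_num) (by norm_num)).mul_left _
  have hbound : ∀ k, ‖horCoeff M a m p (k + 1) * x ^ (k + 1)‖ ≤ 2 * (1 / 8 : ℝ) * (1 / 8 : ℝ) ^ k := by
    intro k
    rw [norm_mul, norm_pow]
    have hc := norm_horCoeff_le h m hR hp hpR (k + 1)
    calc ‖horCoeff M a m p (k + 1)‖ * ‖x‖ ^ (k + 1)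
        ≤ 2 * (horRho M a R)⁻¹ ^ (k + 1) * ‖x‖ ^ (k + 1) := by gcongr
      _ = 2 * (‖x‖ * (horRho M a R)⁻¹) ^ (k + 1) := by ring
      _ ≤ 2 * (1 / 8 : ℝ) ^ (k + 1) := by gcongr
      _ = 2 * (1 / 8 : ℝ) * (1 / 8 : ℝ) ^ k := by ring
  have key := hs1.norm_le_of_bounded hgeom hbound
  have e : horU M a m p r = horFun M a m p x := rfl
  rw [e]
  refine key.trans ?_
  norm_num

/-- In particular `u(r; p) ≠ 0` and `re u(r; p) ≥ 5/7` there. [folklore] -/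
theorem re_horU_ge (h : Kerr.IsSubextremal M a) {R : ℝ} (hR : 0 ≤ R) {p : ℂ × ℂ × ℂ}
    (hp : p ∈ horGood M a) (hpR : p ∈ horBoxClosed R) {r : ℝ} (hr : |r - Kerr.rPlus M a| ≤ horRho M a R / 8) :
    5 / 7 ≤ (horU M a m p r).re ∧ horU M a m p r ≠ 0 := by
  have hb := norm_horU_sub_one_le (m := m) h hR hp hpR hr
  have hre : |(horU M a m p r - 1).re| ≤ 2 / 7 := (Complex.abs_re_le_norm _).trans hb
  rw [Complex.sub_re, Complex.one_re] at hre
  have h1 : 5 / 7 ≤ (horU M a m p r).re := by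
    have := neg_le_of_abs_le hre; linarith
  refine ⟨h1, fun h0 ↦ ?_⟩
  rw [h0, Complex.zero_re] at h1
  linarith

/-- **Reality at threshold.** For real `Λ, σ` and every `r > r₊`: `conj Φ₀ · y(r)` and
`conj Φ₀ · y'(r)` are real (their imaginary parts vanish). Indeed `im(y' ȳ) = am − 2Mω₀r₊ = 0`
makes `W(y, ȳ) = 0`, so `ȳ = c y`; comparing with `y = √Δ Φ u`, `u(r₊) = 1`, at the horizon gives
`c = conj Φ₀ / Φ₀`. [cite: ShlapentokhRothman2014KleinGordon, §4.2] -/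
theorem im_conj_thrPhase0_mul_radY (h : Kerr.IsSubextremal M a) (Λ σ : ℝ) {r : ℝ} (hr : Kerr.rPlus M a < r) :
    (conj (thrPhase0 M a m) * radY M a m (thrP M a m Λ σ) r).im = 0 ∧
      (conj (thrPhase0 M a m) * radY₁ M a m (thrP M a m Λ σ) r).im = 0 := by
  set p := thrP M a m (Λ : ℂ) (σ : ℂ) with hp_def
  have hp : p ∈ horGood M a := thrP_mem_horGood h _ _
  set R := radR p with hR_def
  have hR : 0 ≤ R := radR_nonneg p
  have hpR : p ∈ horBoxClosed R := mem_horBoxClosed_radR p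
  have hρ := horRho_pos h hR
  have hsol := isSol2_radY (m := m) h.le p
  have hpeq : p = (((omega0 M a m : ℝ) : ℂ), (Λ : ℂ), (σ : ℂ)) := rfl
  -- the conjugate pair solves the same equation
  have hsolc : IsSol2 (radQ M a m p) (fun t ↦ conj (radY M a m p t)) (fun t ↦ conj (radY₁ M a m p t))
      (Ioi (Kerr.rPlus M a)) := by
    have hc := isSol2_conj hsol
    have hQ : (fun t ↦ conj (radQ M a m p t)) = radQ M a m p := by
      funext t; rw [hpeq]; exact conj_radQ_ofReal _ _ _ t
    rwa [hQ] at hc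
  -- the Wronskian `W(y, ȳ)` vanishes identically
  have hW : ∀ t ∈ Ioi (Kerr.rPlus M a), wronskian (radY M a m p) (radY₁ M a m p)
      (fun t ↦ conj (radY M a m p t)) (fun t ↦ conj (radY₁ M a m p t)) t = 0 := by
    intro t ht
    have hcur := im_radY₁_mul_conj (m := m) h (omega0 M a m) Λ σ ht
    rw [am_sub_omega0 h] at hcur
    have hX : radY₁ M a m p t * conj (radY M a m p t) = conj (radY₁ M a m p t * conj (radY M a m p t)) := by
      exact (Complex.conj_eq_iff_im.2 hcur).symm
    simp only [wronskian]
    rw [map_mul, Complex.conj_conj] at hX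
    linear_combination -hX
  -- a point near `r₊` with non-zero data
  set t₀ : ℝ := Kerr.rPlus M a + horRho M a R / 8 with ht₀
  have ht₀r : Kerr.rPlus M a < t₀ := by simp only [ht₀]; linarith
  have ht₀I : t₀ ∈ Ioo (Kerr.rPlus M a) (Kerr.rPlus M a + horRho M a R / 2) := ⟨ht₀r, by simp only [ht₀]; linarith⟩
  have ht₀abs : |t₀ - Kerr.rPlus M a| ≤ horRho M a R / 8 := by
    rw [abs_of_nonneg (by simp only [ht₀]; linarith)]; simp only [ht₀]; linarith
  have hu0 := (re_horU_ge (m := m) h hR hp hpR ht₀abs).2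
  have hy0 : radY M a m p t₀ ≠ 0 := by
    rw [(radY_eq_loc (m := m) h hR hp hpR ht₀I).1]
    exact mul_ne_zero (radG_ne_zero h _ ht₀r) hu0
  obtain ⟨c, hc, hc'⟩ := hsol.exists_eq_smul_of_wronskian_eq_zero (continuousOn_radQ h.le p) hsolc ht₀r
    (hW t₀ ht₀r) (Or.inl hy0)
  -- identify `c = conj Φ₀ / Φ₀` from the behaviour at `r₊`
  set Φ := radPhase M a m (omega0 M a m) with hΦ
  have hΦc : ContinuousAt Φ (Kerr.rPlus M a) := continuousAt_radPhase_omega0 h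
  obtain ⟨hcu, -⟩ := continuousAt_horU_rPlus (m := m) h hR hp hpR
  set e : ℝ → ℂ := fun s ↦ conj (Φ s * horU M a m p s) - c * (Φ s * horU M a m p s) with he
  have hce : ContinuousAt e (Kerr.rPlus M a) :=
    ((Complex.continuous_conj.continuousAt.comp (hΦc.mul hcu))).sub (continuousAt_const.mul (hΦc.mul hcu))
  have he0 : ∀ s ∈ Ioo (Kerr.rPlus M a) (Kerr.rPlus M a + horRho M a R / 2), e s = 0 := by
    intro s hs
    have hys := (radY_eq_loc (m := m) h hR hp hpR hs).1
    have hcs : conj (radY M a m p s) = c * radY M a m p s := hc hs.1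
    rw [hys, radG] at hcs
    -- `conj (√Δ Φ u) = c √Δ Φ u`, divide by `√Δ ≠ 0`
    have hΔ := Kerr.delta_pos h.le hs.1
    have hs0 : ((Real.sqrt (Kerr.delta M a s) : ℝ) : ℂ) ≠ 0 := by exact_mod_cast (Real.sqrt_pos.2 hΔ).ne'
    rw [mul_assoc, map_mul, Complex.conj_ofReal, mul_left_comm] at hcs
    have := mul_left_cancel₀ hs0 hcs
    simp only [he, hΦ] at this ⊢
    rw [hp_def, thrP_fst] at this
    linear_combination this
  have hlim1 : Tendsto e (𝓝[>] Kerr.rPlus M a) (𝓝 (e (Kerr.rPlus M a))) := hce.continuousWithinAt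
  have hlim2 : Tendsto e (𝓝[>] Kerr.rPlus M a) (𝓝 0) := by
    refine (tendsto_const_nhds (x := (0 : ℂ))).congr' ?_
    filter_upwards [Ioo_mem_nhdsGT (show Kerr.rPlus M a < Kerr.rPlus M a + horRho M a R / 2 by linarith)]
      with s hs using (he0 s hs).symm
  have hcΦ : conj (thrPhase0 M a m) = c * thrPhase0 M a m := by
    have := tendsto_nhds_unique hlim1 hlim2
    simp only [he, horU_rPlus h, mul_one] at this
    exact sub_eq_zero.1 this
  have hcval : c = conj (thrPhase0 M a m) * conj (thrPhase0 M a m) := by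
    have h1 : conj (thrPhase0 M a m) * conj (thrPhase0 M a m) = c * thrPhase0 M a m * conj (thrPhase0 M a m) :=
      congrArg (· * conj (thrPhase0 M a m)) hcΦ
    rw [mul_assoc, thrPhase0_mul_conj, mul_one] at h1
    exact h1.symm
  -- conclude: `conj (conj Φ₀ y) = Φ₀ ȳ = Φ₀ c y = conj Φ₀ y`
  have key : ∀ z : ℂ, conj z = c * z → (conj (thrPhase0 M a m) * z).im = 0 := by
    intro z hz
    apply Complex.conj_eq_iff_im.1
    rw [map_mul, Complex.conj_conj, hz, hcval]
    linear_combination (conj (thrPhase0 M a m) * z) * thrPhase0_mul_conj (M := M) (a := a) (m := m)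
  exact ⟨key _ (hc hr), key _ (hc' hr)⟩

end Reality

/-! ### The real threshold solutions `z = conj Φ₀ · y` and their equation -/

section RealFamily

variable (M a : ℝ) (m : ℤ)

/-- **The real horizon-regular threshold solution** `z(r; Λ, σ) = re(conj Φ₀ · y(r; ω₀, Λ, σ))`
(equal to `conj Φ₀ · y`, which is real). [cite: ShlapentokhRothman2014KleinGordon, §4.2] -/
def thrZ (Λ σ : ℝ) (r : ℝ) : ℝ := (conj (thrPhase0 M a m) * radY M a m (thrP M a m Λ σ) r).re

/-- Its derivative `z'`. [folklore] -/
def thrZ₁ (Λ σ : ℝ) (r : ℝ) : ℝ := (conj (thrPhase0 M a m) * radY₁ M a m (thrP M a m Λ σ) r).re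

/-- The real coefficient `q(r; Λ, σ) = re Q(r; ω₀, Λ, σ)` (`Q` is real here). [folklore] -/
def thrQ (Λ σ : ℝ) (r : ℝ) : ℝ := (radQ M a m (thrP M a m Λ σ) r).re

variable {M a m}

/-- `z`, `z₁` as complex numbers are `conj Φ₀ · y`, `conj Φ₀ · y'`. [folklore] -/
theorem thrZ_ofReal (h : Kerr.IsSubextremal M a) (Λ σ : ℝ) {r : ℝ} (hr : Kerr.rPlus M a < r) :
    ((thrZ M a m Λ σ r : ℝ) : ℂ) = conj (thrPhase0 M a m) * radY M a m (thrP M a m Λ σ) r ∧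
      ((thrZ₁ M a m Λ σ r : ℝ) : ℂ) = conj (thrPhase0 M a m) * radY₁ M a m (thrP M a m Λ σ) r := by
  obtain ⟨h0, h1⟩ := im_conj_thrPhase0_mul_radY (m := m) h Λ σ hr
  exact ⟨Complex.ext (by simp [thrZ]) (by simp [thrZ, h0]), Complex.ext (by simp [thrZ₁]) (by simp [thrZ₁, h1])⟩

/-- `y = Φ₀ z`, `y' = Φ₀ z₁`. [folklore] -/
theorem radY_thrP_eq (h : Kerr.IsSubextremal M a) (Λ σ : ℝ) {r : ℝ} (hr : Kerr.rPlus M a < r) :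
    radY M a m (thrP M a m Λ σ) r = thrPhase0 M a m * thrZ M a m Λ σ r ∧
      radY₁ M a m (thrP M a m Λ σ) r = thrPhase0 M a m * thrZ₁ M a m Λ σ r := by
  obtain ⟨h0, h1⟩ := thrZ_ofReal (m := m) h Λ σ hr
  have e := thrPhase0_mul_conj (M := M) (a := a) (m := m)
  constructor
  · rw [h0, ← mul_assoc, e, one_mul]
  · rw [h1, ← mul_assoc, e, one_mul]

/-- `Q` is real: `Q = thrQ` as complex numbers. [folklore] -/
theorem thrQ_ofReal (Λ σ : ℝ) (r : ℝ) : ((thrQ M a m Λ σ r : ℝ) : ℂ) = radQ M a m (thrP M a m Λ σ) r :=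
  Complex.ext (by simp [thrQ]) (by simp [thrQ, thrP, im_radQ_ofReal])

/-- **`z` solves the real equation `z'' = q z` on `(r₊, ∞)`.** [folklore] -/
theorem isSol2_thrZ (h : Kerr.IsSubextremal M a) (Λ σ : ℝ) :
    IsSol2 (thrQ M a m Λ σ) (thrZ M a m Λ σ) (thrZ₁ M a m Λ σ) (Ioi (Kerr.rPlus M a)) := by
  have hsol := (isSol2_radY (m := m) h.le (thrP M a m Λ σ)).smul (conj (thrPhase0 M a m))
  refine ⟨fun t ht ↦ ?_, fun t ht ↦ ?_⟩
  · have h1 := Complex.reCLM.hasFDerivAt.comp_hasDerivAt t (hsol.hasDerivAt t ht)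
    exact h1
  · have h1 := Complex.reCLM.hasFDerivAt.comp_hasDerivAt t (hsol.hasDerivAt_deriv t ht)
    refine h1.congr_deriv ?_
    show (radQ M a m (thrP M a m ↑Λ ↑σ) t * (conj (thrPhase0 M a m) * radY M a m (thrP M a m ↑Λ ↑σ) t)).re =
      thrQ M a m Λ σ t * thrZ M a m Λ σ t
    rw [← (thrZ_ofReal h Λ σ ht).1, ← thrQ_ofReal, ← Complex.ofReal_mul, Complex.ofReal_re]

/-- `q` is continuous on `(r₊, ∞)`. [folklore] -/
theorem continuousOn_thrQ (h : |a| ≤ M) (Λ σ : ℝ) : ContinuousOn (thrQ M a m Λ σ) (Ioi (Kerr.rPlus M a)) :=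
  Complex.continuous_re.comp_continuousOn (continuousOn_radQ h _)

/-- `z(r) → 0` hmm not needed; instead: **`z/√Δ → 1` at the horizon**, quantitatively and uniformly:
for parameters in the box of size `R` and `r ∈ (r₊, r₊ + ρ(R)/8]` with `‖conj Φ₀ Φ(r) − 1‖ ≤ 1/7`,
`z(r) ≥ (√Δ(r))/2 > 0`. [folklore] -/
theorem thrZ_pos_of_near (h : Kerr.IsSubextremal M a) {R : ℝ} (hR : 0 ≤ R) {Λ σ : ℝ}
    (hpR : thrP M a m Λ σ ∈ horBoxClosed R) {r : ℝ} (hr : Kerr.rPlus M a < r)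
    (hr8 : r - Kerr.rPlus M a ≤ horRho M a R / 8)
    (hΦ : ‖conj (thrPhase0 M a m) * radPhase M a m (omega0 M a m) r - 1‖ ≤ 1 / 7) :
    Real.sqrt (Kerr.delta M a r) / 2 ≤ thrZ M a m Λ σ r := by
  set p := thrP M a m (Λ : ℂ) (σ : ℂ) with hp_def
  have hp : p ∈ horGood M a := thrP_mem_horGood h _ _
  have hρ := horRho_pos h hR
  have hrI : r ∈ Ioo (Kerr.rPlus M a) (Kerr.rPlus M a + horRho M a R / 2) := ⟨hr, by linarith⟩
  have hrabs : |r - Kerr.rPlus M a| ≤ horRho M a R / 8 := by rw [abs_of_nonneg (by linarith)]; exact hr8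
  have hu := norm_horU_sub_one_le (m := m) h hR hp hpR hrabs
  have hy := (radY_eq_loc (m := m) h hR hp hpR hrI).1
  rw [show p.1 = (omega0 M a m : ℂ) from rfl] at hy
  -- `z = √Δ · re (conj Φ₀ Φ u)`
  set A : ℂ := conj (thrPhase0 M a m) * radPhase M a m (omega0 M a m) r with hA
  have hz : thrZ M a m Λ σ r = Real.sqrt (Kerr.delta M a r) * (A * horU M a m p r).re := by
    simp only [thrZ, ← hp_def, hy, radG, hA]
    rw [show conj (thrPhase0 M a m) * (((Real.sqrt (Kerr.delta M a r) : ℝ) : ℂ) * radPhase M a m (omega0 M a m) r *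
        horU M a m p r) = ((Real.sqrt (Kerr.delta M a r) : ℝ) : ℂ) *
        (conj (thrPhase0 M a m) * radPhase M a m (omega0 M a m) r * horU M a m p r) by ring,
      Complex.re_ofReal_mul]
  -- `‖A u − 1‖ ≤ ‖A − 1‖‖u‖ + ‖u − 1‖ ≤ (1/7)(9/7) + 2/7 < 1/2`
  have hun : ‖horU M a m p r‖ ≤ 9 / 7 := by
    have := norm_le_of_mem_closedBall (a := (1 : ℂ)) (mem_closedBall_iff_norm.2 hu)
    calc ‖horU M a m p r‖ = ‖(horU M a m p r - 1) + 1‖ := by ring_nf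
      _ ≤ ‖horU M a m p r - 1‖ + ‖(1 : ℂ)‖ := norm_add_le _ _
      _ ≤ 2 / 7 + 1 := by rw [norm_one]; gcongr
      _ = 9 / 7 := by norm_num
  have hAu : ‖A * horU M a m p r - 1‖ ≤ 1 / 2 := by
    calc ‖A * horU M a m p r - 1‖ = ‖(A - 1) * horU M a m p r + (horU M a m p r - 1)‖ := by ring_nf
      _ ≤ ‖(A - 1) * horU M a m p r‖ + ‖horU M a m p r - 1‖ := norm_add_le _ _
      _ ≤ 1 / 7 * (9 / 7) + 2 / 7 := by rw [norm_mul]; gcongr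
      _ ≤ 1 / 2 := by norm_num
  have hre : 1 / 2 ≤ (A * horU M a m p r).re := by
    have h1 : |(A * horU M a m p r - 1).re| ≤ 1 / 2 := (Complex.abs_re_le_norm _).trans hAu
    rw [Complex.sub_re, Complex.one_re] at h1
    have := neg_le_of_abs_le h1; linarith
  rw [hz]
  have hs : 0 ≤ Real.sqrt (Kerr.delta M a r) := Real.sqrt_nonneg _
  nlinarith

/-- The set of `r` near `r₊` where `‖conj Φ₀ Φ(r) − 1‖ ≤ 1/7`: there is `η > 0` (depending only on
`M, a, m`) with this for all `r ∈ [r₊, r₊ + η]`. [folklore] -/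
theorem exists_eta_radPhase (h : Kerr.IsSubextremal M a) :
    ∃ η > 0, ∀ r, Kerr.rPlus M a ≤ r → r ≤ Kerr.rPlus M a + η →
      ‖conj (thrPhase0 M a m) * radPhase M a m (omega0 M a m) r - 1‖ ≤ 1 / 7 := by
  have hc : ContinuousAt (fun r ↦ conj (thrPhase0 M a m) * radPhase M a m (omega0 M a m) r) (Kerr.rPlus M a) :=
    continuousAt_const.mul (continuousAt_radPhase_omega0 h)
  have h0 : conj (thrPhase0 M a m) * radPhase M a m (omega0 M a m) (Kerr.rPlus M a) = 1 := conj_thrPhase0_mul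
  have := Metric.continuousAt_iff.1 hc (1 / 7) (by norm_num)
  obtain ⟨δ, hδ, hδ'⟩ := this
  refine ⟨δ / 2, by positivity, fun r hr1 hr2 ↦ ?_⟩
  have hd : dist r (Kerr.rPlus M a) < δ := by
    rw [Real.dist_eq, abs_of_nonneg (by linarith)]; linarith
  have := (hδ' hd).le
  rwa [dist_eq_norm, h0] at this

end RealFamily


/-! ### The potential at threshold and the ground-state transform `R = z/√Δ` -/

section GroundState

variable (M a : ℝ) (m : ℤ)

/-- The real potential `V(r; Λ, σ) = re V(r; ω₀, Λ, σ)` at threshold. [folklore] -/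
def thrV (Λ σ : ℝ) (r : ℝ) : ℝ := (radPot M a m (thrP M a m Λ σ) r).re

/-- `S = √Δ`. [folklore] -/
def sqrtDelta (r : ℝ) : ℝ := Real.sqrt (Kerr.delta M a r)

/-- `S' = (r − M)/√Δ`. [folklore] -/
def sqrtDelta₁ (r : ℝ) : ℝ := (r - M) / sqrtDelta M a r

/-- `q₀ = −d²/(4Δ²)`, the coefficient with `(√Δ)'' = q₀ √Δ`. [folklore] -/
def grQ0 (r : ℝ) : ℝ := -(horD M a ^ 2) / (4 * Kerr.delta M a r ^ 2)

/-- The ground-state transform `R = z/√Δ` (a real solution of `Δ(ΔR')' = V R`). [folklore] -/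
def thrR (Λ σ : ℝ) (r : ℝ) : ℝ := thrZ M a m Λ σ r / sqrtDelta M a r

/-- Its derivative `R' = W(√Δ, z)/Δ`. [folklore] -/
def thrR₁ (Λ σ : ℝ) (r : ℝ) : ℝ :=
  wronskian (sqrtDelta M a) (sqrtDelta₁ M a) (thrZ M a m Λ σ) (thrZ₁ M a m Λ σ) r / Kerr.delta M a r

variable {M a m}

/-- **`V` at threshold**: `V = Δ[(σ − ω₀²)r² − 2Mω₀²r + Λ] − 4M²ω₀²(r − r₊)²` (as a complex number).
[cite: ShlapentokhRothman2014KleinGordon, §4.2] -/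
theorem radPot_thrP (h : Kerr.IsSubextremal M a) (Λ σ : ℝ) (r : ℝ) :
    radPot M a m (thrP M a m Λ σ) r =
      ((Kerr.delta M a r * ((σ - omega0 M a m ^ 2) * r ^ 2 - 2 * M * omega0 M a m ^ 2 * r + Λ) -
        4 * M ^ 2 * omega0 M a m ^ 2 * (r - Kerr.rPlus M a) ^ 2 : ℝ) : ℂ) := by
  have h1 := radPot_add_sq_radK (M := M) (a := a) (m := m) (thrP M a m Λ σ) r
  rw [thrP_fst, radK_omega0 h] at h1
  have h2 : radPot M a m (thrP M a m Λ σ) r =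
      -((Kerr.delta M a r : ℝ) : ℂ) * (radW M (thrP M a m Λ σ) r + 2 * Complex.I * M * (omega0 M a m : ℂ)) -
        ((2 * M * omega0 M a m * (r - Kerr.rPlus M a) : ℝ) : ℂ) ^ 2 := by
    linear_combination h1
  rw [h2]
  simp only [radW, thrP_fst, thrP_snd_fst, thrP_snd_snd]
  push_cast
  ring

/-- The real form of the previous identity. [folklore] -/
theorem thrV_eq (h : Kerr.IsSubextremal M a) (Λ σ : ℝ) (r : ℝ) :
    thrV M a m Λ σ r = Kerr.delta M a r * ((σ - omega0 M a m ^ 2) * r ^ 2 - 2 * M * omega0 M a m ^ 2 * r + Λ) -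
      4 * M ^ 2 * omega0 M a m ^ 2 * (r - Kerr.rPlus M a) ^ 2 := by
  rw [thrV, radPot_thrP h, Complex.ofReal_re]

/-- `q = (V − d²/4)/Δ²` (real form of the definition of `Q`). [folklore] -/
theorem thrQ_eq (Λ σ : ℝ) (r : ℝ) :
    thrQ M a m Λ σ r = (thrV M a m Λ σ r - horD M a ^ 2 / 4) / Kerr.delta M a r ^ 2 := by
  rw [thrQ, radQ, Complex.div_ofReal_re, Complex.sub_re, Complex.ofReal_re, thrV]

/-- **A positivity criterion for `V`**: if `(σ − ω₀²)r² − 2Mω₀²r + Λ ≥ 4M²ω₀²` for all `r ≥ r₊`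
then `V ≥ 0` on `[r₊, ∞)` (`Δ ≥ (r − r₊)²`). [cite: ShlapentokhRothman2014KleinGordon, §4.2] -/
theorem thrV_nonneg (h : Kerr.IsSubextremal M a) {Λ σ : ℝ}
    (hbr : ∀ r, Kerr.rPlus M a ≤ r →
      4 * M ^ 2 * omega0 M a m ^ 2 ≤ (σ - omega0 M a m ^ 2) * r ^ 2 - 2 * M * omega0 M a m ^ 2 * r + Λ)
    {r : ℝ} (hr : Kerr.rPlus M a ≤ r) : 0 ≤ thrV M a m Λ σ r := by
  rw [thrV_eq h]
  have hb := hbr r hr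
  have hΔ : (r - Kerr.rPlus M a) ^ 2 ≤ Kerr.delta M a r := by
    rw [Kerr.delta_eq_mul h.le r]
    have := h.rMinus_lt_rPlus
    nlinarith
  have h0 : 0 ≤ 4 * M ^ 2 * omega0 M a m ^ 2 := by positivity
  nlinarith

/-- `S = √Δ > 0`, `S² = Δ` on `(r₊, ∞)`. [folklore] -/
theorem sqrtDelta_pos (h : |a| ≤ M) {r : ℝ} (hr : Kerr.rPlus M a < r) :
    0 < sqrtDelta M a r ∧ sqrtDelta M a r ^ 2 = Kerr.delta M a r :=
  ⟨Real.sqrt_pos.2 (Kerr.delta_pos h hr), Real.sq_sqrt (Kerr.delta_pos h hr).le⟩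

/-- `S' = (r − M)/S`. [folklore] -/
theorem hasDerivAt_sqrtDelta (h : |a| ≤ M) {r : ℝ} (hr : Kerr.rPlus M a < r) :
    HasDerivAt (sqrtDelta M a) (sqrtDelta₁ M a r) r := by
  have hΔ := Kerr.delta_pos h hr
  have h1 := (Kerr.hasDerivAt_delta M a r).sqrt hΔ.ne'
  refine h1.congr_deriv ?_
  have hs : Real.sqrt (Kerr.delta M a r) ≠ 0 := (Real.sqrt_pos.2 hΔ).ne'
  simp only [sqrtDelta₁, sqrtDelta]
  field_simp

/-- **`(√Δ)'' = −d²/(4Δ²) √Δ`** on `(r₊, ∞)`. [folklore] -/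
theorem isSol2_sqrtDelta (h : Kerr.IsSubextremal M a) :
    IsSol2 (grQ0 M a) (sqrtDelta M a) (sqrtDelta₁ M a) (Ioi (Kerr.rPlus M a)) := by
  refine ⟨fun r hr ↦ hasDerivAt_sqrtDelta h.le hr, fun r hr ↦ ?_⟩
  obtain ⟨hS, hS2⟩ := sqrtDelta_pos h.le hr
  have h1 := ((hasDerivAt_id r).sub_const M).div (hasDerivAt_sqrtDelta h.le hr) hS.ne'
  refine h1.congr_deriv ?_
  have hd2 : horD M a ^ 2 = 4 * ((r - M) ^ 2 - sqrtDelta M a r ^ 2) := by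
    rw [hS2]; linarith [sq_deriv_delta h r]
  simp only [grQ0, sqrtDelta₁, id]
  rw [← hS2, hd2]
  field_simp
  ring

/-- **`R = z/S` and its flux**: `R' = W(S, z)/Δ`, and `(Δ R')' = (V/Δ) R` on `(r₊, ∞)`.
[cite: ShlapentokhRothman2014KleinGordon, §2 (2.2)] -/
theorem hasDerivAt_thrR (h : Kerr.IsSubextremal M a) (Λ σ : ℝ) {r : ℝ} (hr : Kerr.rPlus M a < r) :
    HasDerivAt (thrR M a m Λ σ) (thrR₁ M a m Λ σ r) r ∧
      HasDerivAt (fun s ↦ Kerr.delta M a s * thrR₁ M a m Λ σ s)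
        (thrV M a m Λ σ r / Kerr.delta M a r * thrR M a m Λ σ r) r := by
  obtain ⟨hS, hS2⟩ := sqrtDelta_pos h.le hr
  have hΔ := Kerr.delta_pos h.le hr
  have hz := isSol2_thrZ (m := m) h Λ σ
  have hs := isSol2_sqrtDelta h
  constructor
  · have h1 := (hz.hasDerivAt r hr).div (hasDerivAt_sqrtDelta h.le hr) hS.ne'
    refine h1.congr_deriv ?_
    simp only [thrR₁, wronskian]
    rw [← hS2]
    field_simp
  · -- `Δ R₁ = W(S, z)` near `r`
    have hloc : (fun s ↦ Kerr.delta M a s * thrR₁ M a m Λ σ s) =ᶠ[𝓝 r]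
        wronskian (sqrtDelta M a) (sqrtDelta₁ M a) (thrZ M a m Λ σ) (thrZ₁ M a m Λ σ) := by
      filter_upwards [Ioi_mem_nhds hr] with s hs
      have hΔs := Kerr.delta_pos h.le hs
      simp only [thrR₁]
      field_simp
    have hW := hasDerivAt_wronskian₂ hs hz hr
    refine (hW.congr_of_eventuallyEq hloc).congr_deriv ?_
    rw [thrQ_eq, thrR, grQ0, ← hS2]
    field_simp
    ring

/-- **The flux `Δ R'` tends to `0` at the horizon** (`Δ R' = W(√Δ, z) = re(conj Φ₀ Φ (Δ u₁ − iK u))`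
near `r₊`, `K(r₊) = 0`). [cite: ShlapentokhRothman2014KleinGordon, §3.2] -/
theorem tendsto_flux_thrR (h : Kerr.IsSubextremal M a) (Λ σ : ℝ) :
    Tendsto (fun s ↦ Kerr.delta M a s * thrR₁ M a m Λ σ s) (𝓝[>] Kerr.rPlus M a) (𝓝 0) := by
  set p := thrP M a m (Λ : ℂ) (σ : ℂ) with hp_def
  have hp : p ∈ horGood M a := thrP_mem_horGood h _ _
  set R := radR p with hR_def
  have hR : 0 ≤ R := radR_nonneg p
  have hpR : p ∈ horBoxClosed R := mem_horBoxClosed_radR p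
  have hρ := horRho_pos h hR
  set Φ := radPhase M a m (omega0 M a m) with hΦ
  set e : ℝ → ℝ := fun s ↦ (conj (thrPhase0 M a m) * Φ s *
    ((Kerr.delta M a s : ℂ) * horU₁ M a m R p s - Complex.I * radK M a m (omega0 M a m) s * horU M a m p s)).re
    with he
  -- (1) the flux equals `e` near `r₊`
  have hloc : ∀ s ∈ Ioo (Kerr.rPlus M a) (Kerr.rPlus M a + horRho M a R / 2),
      Kerr.delta M a s * thrR₁ M a m Λ σ s = e s := by
    intro s hs
    have hΔ := Kerr.delta_pos h.le hs.1
    obtain ⟨hS, hS2⟩ := sqrtDelta_pos h.le hs.1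
    obtain ⟨hy0, hy1⟩ := radY_eq_loc (m := m) h hR hp hpR hs
    have hp1 : p.1 = (omega0 M a m : ℂ) := rfl
    rw [hp1] at hy0 hy1
    obtain ⟨hz0, hz1⟩ := thrZ_ofReal (m := m) h Λ σ hs.1
    rw [← hp_def] at hz0 hz1
    have e2 := delta_mul_radLogG (m := m) h.le (omega0 M a m : ℂ) hs.1
    -- flux = W(S, z) = S z₁ − S₁ z
    have hflux : Kerr.delta M a s * thrR₁ M a m Λ σ s =
        sqrtDelta M a s * thrZ₁ M a m Λ σ s - sqrtDelta₁ M a s * thrZ M a m Λ σ s := by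
      simp only [thrR₁, wronskian]; field_simp
    rw [hflux]
    -- pass to complex numbers
    apply Complex.ofReal_injective
    have hsq0 : Real.sqrt (Kerr.delta M a s) ≠ 0 := (Real.sqrt_pos.2 hΔ).ne'
    have hSc' : ((Real.sqrt (Kerr.delta M a s) : ℝ) : ℂ) * ((Real.sqrt (Kerr.delta M a s) : ℝ) : ℂ) =
        (Kerr.delta M a s : ℂ) := by
      rw [← Complex.ofReal_mul, Real.mul_self_sqrt hΔ.le]
    have h3 : (((s - M) / Real.sqrt (Kerr.delta M a s) : ℝ) : ℂ) * ((Real.sqrt (Kerr.delta M a s) : ℝ) : ℂ) =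
        ((s - M : ℝ) : ℂ) := by
      rw [← Complex.ofReal_mul, div_mul_cancel₀ _ hsq0]
    have hexpr : conj (thrPhase0 M a m) * Φ s *
        ((Kerr.delta M a s : ℂ) * horU₁ M a m R p s - Complex.I * radK M a m (omega0 M a m) s * horU M a m p s) =
        ((sqrtDelta M a s : ℝ) : ℂ) * ((thrZ₁ M a m Λ σ s : ℝ) : ℂ) -
          ((sqrtDelta₁ M a s : ℝ) : ℂ) * ((thrZ M a m Λ σ s : ℝ) : ℂ) := by
      rw [hz0, hz1, hy0, hy1, radG₁, radG]
      simp only [hΦ, sqrtDelta₁, sqrtDelta]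
      linear_combination (-(conj (thrPhase0 M a m) * radPhase M a m (↑(omega0 M a m)) s * horU M a m p s)) * e2 -
        (conj (thrPhase0 M a m) * radPhase M a m (↑(omega0 M a m)) s *
          (radLogG M a m (↑(omega0 M a m)) s * horU M a m p s + horU₁ M a m R p s)) * hSc' +
        (conj (thrPhase0 M a m) * radPhase M a m (↑(omega0 M a m)) s * horU M a m p s) * h3
    have hre : ((e s : ℝ) : ℂ) = conj (thrPhase0 M a m) * Φ s *
        ((Kerr.delta M a s : ℂ) * horU₁ M a m R p s - Complex.I * radK M a m (omega0 M a m) s * horU M a m p s) := by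
      have him : (conj (thrPhase0 M a m) * Φ s *
          ((Kerr.delta M a s : ℂ) * horU₁ M a m R p s - Complex.I * radK M a m (omega0 M a m) s * horU M a m p s)).im = 0 := by
        rw [hexpr, ← Complex.ofReal_mul, ← Complex.ofReal_mul, ← Complex.ofReal_sub, Complex.ofReal_im]
      exact Complex.ext (by simp [he]) (by simp [he, him])
    rw [hre, hexpr]
    push_cast
    ring
  -- (2) `e` is continuous at `r₊` with value `0`
  obtain ⟨hcu, hcu₁⟩ := continuousAt_horU_rPlus (m := m) h hR hp hpR
  have hcΦ : ContinuousAt Φ (Kerr.rPlus M a) := continuousAt_radPhase_omega0 h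
  have hcK : Continuous fun s : ℝ ↦ radK M a m (omega0 M a m : ℂ) s := by unfold radK; fun_prop
  have hcΔ : Continuous fun s : ℝ ↦ (Kerr.delta M a s : ℂ) := by unfold Kerr.delta; fun_prop
  have hce : ContinuousAt e (Kerr.rPlus M a) := by
    simp only [he]
    exact Complex.continuous_re.continuousAt.comp ((continuousAt_const.mul hcΦ).mul
      ((hcΔ.continuousAt.mul hcu₁).sub ((continuousAt_const.mul hcK.continuousAt).mul hcu)))
  have he0 : e (Kerr.rPlus M a) = 0 := by
    simp [he, radK_omega0 h, Kerr.delta_rPlus h.le]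
  have hlim : Tendsto e (𝓝[>] Kerr.rPlus M a) (𝓝 0) := he0 ▸ hce.continuousWithinAt
  refine hlim.congr' ?_
  filter_upwards [Ioo_mem_nhdsGT (show Kerr.rPlus M a < Kerr.rPlus M a + horRho M a R / 2 by linarith)]
    with s hs using (hloc s hs).symm

/-- **Positivity of `z` near the horizon** (per parameter): there is `r₁ > r₊` with `z > 0` on
`(r₊, r₁]`. [folklore] -/
theorem exists_thrZ_pos_near (h : Kerr.IsSubextremal M a) (Λ σ : ℝ) :
    ∃ r₁, Kerr.rPlus M a < r₁ ∧ ∀ r ∈ Ioc (Kerr.rPlus M a) r₁, 0 < thrZ M a m Λ σ r := by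
  set p := thrP M a m (Λ : ℂ) (σ : ℂ) with hp_def
  set R := radR p with hR_def
  have hR : 0 ≤ R := radR_nonneg p
  have hpR : p ∈ horBoxClosed R := mem_horBoxClosed_radR p
  have hρ := horRho_pos h hR
  obtain ⟨η, hη, hηΦ⟩ := exists_eta_radPhase (M := M) (a := a) (m := m) h
  refine ⟨Kerr.rPlus M a + min (horRho M a R / 8) η, by
    have := lt_min (by linarith : (0 : ℝ) < horRho M a R / 8) hη; linarith, fun r hr ↦ ?_⟩
  have h1 : r - Kerr.rPlus M a ≤ horRho M a R / 8 := by linarith [hr.2, min_le_left (horRho M a R / 8) η]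
  have h2 : r ≤ Kerr.rPlus M a + η := by linarith [hr.2, min_le_right (horRho M a R / 8) η]
  have hz := thrZ_pos_of_near (m := m) h hR hpR hr.1 h1 (hηΦ r hr.1.le h2)
  have hS := Real.sqrt_pos.2 (Kerr.delta_pos h.le hr.1)
  linarith

/-- **`V ≥ 0` on `(r₊, ∞)` forces `z > 0` on `(r₊, ∞)`** (the maximum principle for
`Δ(ΔR')' = V R` at the horizon, `pos_of_flux_tendsto_zero`).
[cite: ShlapentokhRothman2014KleinGordon, §3.2 and §4.2] -/
theorem thrZ_pos_of_thrV_nonneg (h : Kerr.IsSubextremal M a) {Λ σ : ℝ}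
    (hV : ∀ r, Kerr.rPlus M a < r → 0 ≤ thrV M a m Λ σ r) : ∀ r, Kerr.rPlus M a < r → 0 < thrZ M a m Λ σ r := by
  obtain ⟨r₁, hr₁, hpos⟩ := exists_thrZ_pos_near (m := m) h Λ σ
  have hsol : ∀ t ∈ Ioi (Kerr.rPlus M a), HasDerivAt (thrR M a m Λ σ) (thrR₁ M a m Λ σ t) t ∧
      HasDerivAt (fun s ↦ Kerr.delta M a s * thrR₁ M a m Λ σ s)
        (thrV M a m Λ σ t / Kerr.delta M a t * thrR M a m Λ σ t) t := fun t ht ↦ hasDerivAt_thrR h Λ σ ht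
  have hP : ∀ t ∈ Ioi (Kerr.rPlus M a), 0 < Kerr.delta M a t := fun t ht ↦ Kerr.delta_pos h.le ht
  have hG : ∀ t ∈ Ioi (Kerr.rPlus M a), 0 ≤ thrV M a m Λ σ t / Kerr.delta M a t := fun t ht ↦
    div_nonneg (hV t ht) (hP t ht).le
  have hinit : ∀ t ∈ Ioc (Kerr.rPlus M a) r₁, 0 < thrR M a m Λ σ t := fun t ht ↦
    div_pos (hpos t ht) (sqrtDelta_pos h.le ht.1).1
  have key := pos_of_flux_tendsto_zero hsol hP hG (tendsto_flux_thrR h Λ σ) hr₁ hinit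
  intro r hr
  have hRr := key r hr
  have hS := (sqrtDelta_pos h.le hr).1
  have : thrZ M a m Λ σ r = thrR M a m Λ σ r * sqrtDelta M a r := by
    rw [thrR, div_mul_cancel₀ _ hS.ne']
  rw [this]
  exact mul_pos hRr hS

end GroundState


/-! ### One-parameter threshold families `μ ↦ (ω₀, Λ(μ), μ²)`: continuity in `μ` -/

section Family

variable {M a : ℝ} {m : ℤ}

/-- Strict monotonicity of `q` in `(Λ, σ)`: `q(Λ, σ) < q(Λ', σ')` on `(r₊, ∞)` when `Λ ≤ Λ'`, `σ < σ'`
(`∂q/∂Λ = 1/Δ`, `∂q/∂σ = r²/Δ`). [folklore] -/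
theorem thrQ_lt_thrQ (h : Kerr.IsSubextremal M a) {Λ Λ' σ σ' : ℝ} (hΛ : Λ ≤ Λ') (hσ : σ < σ') {r : ℝ}
    (hr : Kerr.rPlus M a < r) : thrQ M a m Λ σ r < thrQ M a m Λ' σ' r := by
  have hΔ := Kerr.delta_pos h.le hr
  have hrp := rPlus_pos_of_isSubextremal h
  rw [thrQ_eq, thrQ_eq, thrV_eq h, thrV_eq h, div_lt_div_iff_of_pos_right (pow_pos hΔ 2)]
  have hr0 : 0 < r := hrp.trans hr
  have hr2 : 0 < r ^ 2 := by positivity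
  nlinarith [mul_pos hΔ hr2, mul_pos hΔ (sub_pos.2 hσ)]

/-- The parameter map `μ ↦ (ω₀, Λ(μ), μ²)` is continuous when `Λ` is. [folklore] -/
theorem continuous_thrP_family {Lam : ℝ → ℝ} (hLam : Continuous Lam) :
    Continuous fun μ : ℝ ↦ thrP M a m (Lam μ) ((μ ^ 2 : ℝ) : ℂ) := by
  unfold thrP; fun_prop

/-- Norm bookkeeping: `(ω₀, Λ, σ)` with `|Λ| < L`, `|σ| < L'` lies in the open box of size
`|ω₀| + L + L' + 1`. [folklore] -/
theorem thrP_mem_horBox {Λ σ L L' : ℝ} (hΛ : |Λ| < L) (hσ : |σ| < L') (hL : 0 ≤ L) (hL' : 0 ≤ L') :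
    thrP M a m Λ σ ∈ horBox (|omega0 M a m| + L + L' + 1) := by
  refine ⟨?_, ?_, ?_⟩
  · simp only [thrP_fst, Complex.norm_real, Real.norm_eq_abs]; linarith
  · simp only [thrP_snd_fst, Complex.norm_real, Real.norm_eq_abs]; linarith [abs_nonneg (omega0 M a m)]
  · simp only [thrP_snd_snd, Complex.norm_real, Real.norm_eq_abs]; linarith [abs_nonneg (omega0 M a m)]

/-- **Uniform convergence in the parameter** for the family `μ ↦ (y, y')(·; ω₀, Λ(μ), μ²)` on every
compact `[a', b'] ⊂ (r₊, ∞)`, `Λ` continuous. [cite: Hartman2002, Ch. V Thm. 2.1] -/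
theorem tendstoUniformlyOn_radY_family (h : Kerr.IsSubextremal M a) {Lam : ℝ → ℝ} (hLam : Continuous Lam)
    (μ₀ : ℝ) {a' : ℝ} (b' : ℝ) (ha' : Kerr.rPlus M a < a') :
    TendstoUniformlyOn
      (fun μ t ↦ (radY M a m (thrP M a m (Lam μ) ((μ ^ 2 : ℝ) : ℂ)) t, radY₁ M a m (thrP M a m (Lam μ) ((μ ^ 2 : ℝ) : ℂ)) t))
      (fun t ↦ (radY M a m (thrP M a m (Lam μ₀) ((μ₀ ^ 2 : ℝ) : ℂ)) t, radY₁ M a m (thrP M a m (Lam μ₀) ((μ₀ ^ 2 : ℝ) : ℂ)) t))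
      (𝓝 μ₀) (Icc a' b') := by
  set P : ℝ → ℂ × ℂ × ℂ := fun μ ↦ thrP M a m (Lam μ) ((μ ^ 2 : ℝ) : ℂ) with hP
  have hPc : Continuous P := continuous_thrP_family hLam
  -- a box containing `P μ₀` in its interior
  set R : ℝ := |omega0 M a m| + (|Lam μ₀| + 1) + (|μ₀ ^ 2| + 1) + 1 with hR_def
  have hR : 0 ≤ R := by positivity
  have hP₀ : P μ₀ ∈ horBox R := thrP_mem_horBox (by linarith) (by linarith) (by positivity) (by positivity)
  have hgood : ∀ μ, P μ ∈ horGood M a := fun μ ↦ thrP_mem_horGood h _ _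
  have hev : ∀ᶠ μ in 𝓝 μ₀, P μ ∈ horBox R := hPc.continuousAt.preimage_mem_nhds ((isOpen_horBox R).mem_nhds hP₀)
  have hρ := horRho_pos h hR
  set t₁ : ℝ := Kerr.rPlus M a + horRho M a R / 4 with ht₁
  have ht₁I : t₁ ∈ Ioo (Kerr.rPlus M a) (Kerr.rPlus M a + horRho M a R / 2) := by
    simp only [ht₁]; constructor <;> linarith
  have hx₁ : ‖((t₁ : ℂ) - Kerr.rPlus M a)‖ < horRho M a R / 2 := by
    rw [← Complex.ofReal_sub, Complex.norm_real, Real.norm_eq_abs, abs_lt]; simp only [ht₁]; constructor <;> linarith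
  -- the enlarged interval
  set A : ℝ := min a' t₁ with hA
  set B : ℝ := max b' t₁ with hB
  have hAB : Icc A B ⊆ Ioi (Kerr.rPlus M a) := fun t ht ↦
    lt_of_lt_of_le (lt_min ha' ht₁I.1) ht.1
  have ht₁AB : t₁ ∈ Icc A B := ⟨min_le_right _ _, le_max_right _ _⟩
  -- continuity of the data at `t₁`
  obtain ⟨hcU, hcU₁⟩ := contDiffOn_horFun_param h m hR hx₁ (n := 0) (by exact_mod_cast le_top)
  have hdata0 : ContinuousAt (fun μ ↦ radY M a m (P μ) t₁) μ₀ := by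
    have hc : ContinuousAt (fun μ ↦ radG M a m (omega0 M a m) t₁ * horFun M a m (P μ) ((t₁ : ℂ) - Kerr.rPlus M a)) μ₀ :=
      continuousAt_const.mul ((hcU.continuousOn.continuousAt (((isOpen_horGood M a).inter (isOpen_horBox R)).mem_nhds
        ⟨hgood μ₀, hP₀⟩)).comp hPc.continuousAt)
    refine hc.congr ?_
    filter_upwards [hev] with μ hμ
    rw [(radY_eq_loc (m := m) h hR (hgood μ) (horBox_subset_horBoxClosed R hμ) ht₁I).1]
    rfl
  have hdata1 : ContinuousAt (fun μ ↦ radY₁ M a m (P μ) t₁) μ₀ := by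
    have hc : ContinuousAt (fun μ ↦ radG₁ M a m (omega0 M a m) t₁ * horFun M a m (P μ) ((t₁ : ℂ) - Kerr.rPlus M a) +
        radG M a m (omega0 M a m) t₁ * horDer M a m R (P μ) ((t₁ : ℂ) - Kerr.rPlus M a)) μ₀ :=
      (continuousAt_const.mul ((hcU.continuousOn.continuousAt (((isOpen_horGood M a).inter (isOpen_horBox R)).mem_nhds
        ⟨hgood μ₀, hP₀⟩)).comp hPc.continuousAt)).add
      (continuousAt_const.mul ((hcU₁.continuousOn.continuousAt (((isOpen_horGood M a).inter (isOpen_horBox R)).mem_nhds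
        ⟨hgood μ₀, hP₀⟩)).comp hPc.continuousAt))
    refine hc.congr ?_
    filter_upwards [hev] with μ hμ
    rw [(radY_eq_loc (m := m) h hR (hgood μ) (horBox_subset_horBoxClosed R hμ) ht₁I).2]
    rfl
  -- solutions in separated form
  have hsol : ∀ μ, IsSol2 (fun t ↦ ∑ i, radMon i (P μ) * radH M a m i t) (radY M a m (P μ)) (radY₁ M a m (P μ))
      (Ioi (Kerr.rPlus M a)) := fun μ ↦
    (isSol2_radY (m := m) h.le (P μ)).congr_coeff fun t ht ↦ radQ_eq_sum h.le (P μ) ht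
  have hU := tendstoUniformlyOn_param_of_data hAB ht₁AB (fun i ↦ ((contDiff_radMon i).continuous.comp hPc).continuousAt)
    (fun i ↦ continuousOn_radH h.le i) hsol hdata0 hdata1
  exact hU.mono (Icc_subset_Icc (min_le_left _ _) (le_max_left _ _))

/-- **Uniform convergence of the real threshold family** `μ ↦ (z, z₁)(·; Λ(μ), μ²)` on compacts.
[cite: Hartman2002, Ch. V Thm. 2.1] -/
theorem tendstoUniformlyOn_thrZ_family (h : Kerr.IsSubextremal M a) {Lam : ℝ → ℝ} (hLam : Continuous Lam)
    (μ₀ : ℝ) {a' : ℝ} (b' : ℝ) (ha' : Kerr.rPlus M a < a') :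
    TendstoUniformlyOn (fun μ t ↦ (thrZ M a m (Lam μ) (μ ^ 2) t, thrZ₁ M a m (Lam μ) (μ ^ 2) t))
      (fun t ↦ (thrZ M a m (Lam μ₀) (μ₀ ^ 2) t, thrZ₁ M a m (Lam μ₀) (μ₀ ^ 2) t)) (𝓝 μ₀) (Icc a' b') := by
  have hU := tendstoUniformlyOn_radY_family (m := m) h hLam μ₀ b' ha'
  rw [Metric.tendstoUniformlyOn_iff] at hU ⊢
  intro ε hε
  filter_upwards [hU ε hε] with μ hμ t ht
  have h1 := hμ t ht
  rw [Prod.dist_eq, max_lt_iff] at h1 ⊢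
  simp only [dist_eq_norm] at h1 ⊢
  have key : ∀ z w : ℂ, |(conj (thrPhase0 M a m) * z).re - (conj (thrPhase0 M a m) * w).re| ≤ ‖z - w‖ := by
    intro z w
    rw [← Complex.sub_re, ← mul_sub]
    refine (Complex.abs_re_le_norm _).trans ?_
    rw [norm_mul, Complex.norm_conj, norm_thrPhase0, one_mul]
  simp only [thrZ, thrZ₁, Real.norm_eq_abs]
  exact ⟨(key _ _).trans_lt h1.1, (key _ _).trans_lt h1.2⟩

/-- **Joint continuity** of `(μ, t) ↦ z(t; Λ(μ), μ²)` and of `z₁` on `ℝ × (r₊, ∞)`.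
[cite: Hartman2002, Ch. V Thm. 2.1] -/
theorem continuousAt_thrZ_family (h : Kerr.IsSubextremal M a) {Lam : ℝ → ℝ} (hLam : Continuous Lam)
    {μ₀ t₀ : ℝ} (ht₀ : Kerr.rPlus M a < t₀) :
    ContinuousAt (fun q : ℝ × ℝ ↦ thrZ M a m (Lam q.1) (q.1 ^ 2) q.2) (μ₀, t₀) ∧
      ContinuousAt (fun q : ℝ × ℝ ↦ thrZ₁ M a m (Lam q.1) (q.1 ^ 2) q.2) (μ₀, t₀) := by
  set a' : ℝ := (Kerr.rPlus M a + t₀) / 2 with ha'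
  have ha'r : Kerr.rPlus M a < a' := by simp only [ha']; linarith
  have hs : Icc a' (t₀ + 1) ∈ 𝓝 t₀ := Icc_mem_nhds (by simp only [ha']; linarith) (by linarith)
  have hU := tendstoUniformlyOn_thrZ_family (m := m) h hLam μ₀ (t₀ + 1) ha'r
  have hsol := isSol2_thrZ (m := m) h (Lam μ₀) (μ₀ ^ 2)
  have hc0 : ContinuousAt (thrZ M a m (Lam μ₀) (μ₀ ^ 2)) t₀ :=
    (hsol.hasDerivAt t₀ ht₀).continuousAt
  have hc1 : ContinuousAt (thrZ₁ M a m (Lam μ₀) (μ₀ ^ 2)) t₀ :=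
    (hsol.hasDerivAt_deriv t₀ ht₀).continuousAt
  -- split the pair convergence into components
  have hU0 : TendstoUniformlyOn (fun μ t ↦ thrZ M a m (Lam μ) (μ ^ 2) t) (fun t ↦ thrZ M a m (Lam μ₀) (μ₀ ^ 2) t)
      (𝓝 μ₀) (Icc a' (t₀ + 1)) := by
    rw [Metric.tendstoUniformlyOn_iff] at hU ⊢
    intro ε hε
    filter_upwards [hU ε hε] with μ hμ t ht
    have := hμ t ht
    rw [Prod.dist_eq, max_lt_iff] at this
    exact this.1
  have hU1 : TendstoUniformlyOn (fun μ t ↦ thrZ₁ M a m (Lam μ) (μ ^ 2) t) (fun t ↦ thrZ₁ M a m (Lam μ₀) (μ₀ ^ 2) t)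
      (𝓝 μ₀) (Icc a' (t₀ + 1)) := by
    rw [Metric.tendstoUniformlyOn_iff] at hU ⊢
    intro ε hε
    filter_upwards [hU ε hε] with μ hμ t ht
    have := hμ t ht
    rw [Prod.dist_eq, max_lt_iff] at this
    exact this.2
  exact ⟨continuousAt_uncurry_of_tendstoUniformlyOn (F := fun μ t ↦ thrZ M a m (Lam μ) (μ ^ 2) t) hs hU0 hc0,
    continuousAt_uncurry_of_tendstoUniformlyOn (F := fun μ t ↦ thrZ₁ M a m (Lam μ) (μ ^ 2) t) hs hU1 hc1⟩

/-- Joint continuity on `S ×ˢ (r₊, ∞)` in the `ContinuousOn` form. [folklore] -/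
theorem continuousOn_thrZ_family (h : Kerr.IsSubextremal M a) {Lam : ℝ → ℝ} (hLam : Continuous Lam) (S : Set ℝ) :
    ContinuousOn (fun q : ℝ × ℝ ↦ thrZ M a m (Lam q.1) (q.1 ^ 2) q.2) (S ×ˢ Ioi (Kerr.rPlus M a)) ∧
      ContinuousOn (fun q : ℝ × ℝ ↦ thrZ₁ M a m (Lam q.1) (q.1 ^ 2) q.2) (S ×ˢ Ioi (Kerr.rPlus M a)) :=
  ⟨fun q hq ↦ (continuousAt_thrZ_family (m := m) h hLam (μ₀ := q.1) hq.2).1.continuousWithinAt,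
    fun q hq ↦ (continuousAt_thrZ_family (m := m) h hLam (μ₀ := q.1) hq.2).2.continuousWithinAt⟩

/-- **Uniform positivity near the horizon**: for `μ` in a compact interval `[μa, μb]` (`0 ≤ μa`),
there is `r₁ > r₊` with `z(t; Λ(μ), μ²) > 0` for all `t ∈ (r₊, r₁]` and all such `μ`. [folklore] -/
theorem exists_thrZ_pos_near_uniform (h : Kerr.IsSubextremal M a) {Lam : ℝ → ℝ} (hLam : Continuous Lam)
    {μa μb : ℝ} (hμa : 0 ≤ μa) :
    ∃ r₁, Kerr.rPlus M a < r₁ ∧ ∀ μ ∈ Icc μa μb, ∀ t ∈ Ioc (Kerr.rPlus M a) r₁, 0 < thrZ M a m (Lam μ) (μ ^ 2) t := by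
  -- a common box
  obtain ⟨L, hL⟩ : ∃ L, ∀ μ ∈ Icc μa μb, |Lam μ| ≤ L := by
    obtain ⟨L, hL⟩ := isCompact_Icc.exists_bound_of_continuousOn (hLam.continuousOn (s := Icc μa μb))
    exact ⟨L, fun μ hμ ↦ by simpa [Real.norm_eq_abs] using hL μ hμ⟩
  set R : ℝ := |omega0 M a m| + (|L| + 1) + (μb ^ 2 + 1) + 1 with hR_def
  have hR : 0 ≤ R := by positivity
  have hbox : ∀ μ ∈ Icc μa μb, thrP M a m (Lam μ) ((μ ^ 2 : ℝ) : ℂ) ∈ horBoxClosed R := by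
    intro μ hμ
    refine horBox_subset_horBoxClosed R (thrP_mem_horBox ?_ ?_ (by positivity) (by positivity))
    · linarith [hL μ hμ, le_abs_self L]
    · rw [abs_of_nonneg (sq_nonneg μ)]
      have : μ ^ 2 ≤ μb ^ 2 := by
        have h1 : 0 ≤ μ := hμa.trans hμ.1
        nlinarith [hμ.2]
      linarith
  have hρ := horRho_pos h hR
  obtain ⟨η, hη, hηΦ⟩ := exists_eta_radPhase (M := M) (a := a) (m := m) h
  refine ⟨Kerr.rPlus M a + min (horRho M a R / 8) η, by
    have := lt_min (by linarith : (0 : ℝ) < horRho M a R / 8) hη; linarith, fun μ hμ t ht ↦ ?_⟩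
  have h1 : t - Kerr.rPlus M a ≤ horRho M a R / 8 := by linarith [ht.2, min_le_left (horRho M a R / 8) η]
  have h2 : t ≤ Kerr.rPlus M a + η := by linarith [ht.2, min_le_right (horRho M a R / 8) η]
  have hz := thrZ_pos_of_near (m := m) h hR (Λ := Lam μ) (σ := μ ^ 2) (by exact_mod_cast hbox μ hμ) ht.1 h1
    (hηΦ t ht.1.le h2)
  have hS := Real.sqrt_pos.2 (Kerr.delta_pos h.le ht.1)
  linarith

/-- **`q ≥ c > 0` far out, uniformly**: for `μ ∈ [μa, μb]` with `μa > |ω₀|` there are `S > r₊`,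
`c > 0`, `K` with `c ≤ q(t; Λ(μ), μ²)` and `|q(t; Λ(μ), μ²)| ≤ K` for `t ≥ S`. [folklore] -/
theorem exists_thrQ_ge_uniform (h : Kerr.IsSubextremal M a) {Lam : ℝ → ℝ} (hLam : Continuous Lam)
    {μa μb : ℝ} (hμa : |omega0 M a m| < μa) :
    ∃ S c K : ℝ, Kerr.rPlus M a < S ∧ 0 < c ∧ ∀ μ ∈ Icc μa μb, ∀ t ∈ Ici S,
      c ≤ thrQ M a m (Lam μ) (μ ^ 2) t ∧ |thrQ M a m (Lam μ) (μ ^ 2) t| ≤ K := by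
  obtain ⟨L, hL⟩ : ∃ L, ∀ μ ∈ Icc μa μb, |Lam μ| ≤ L := by
    obtain ⟨L, hL⟩ := isCompact_Icc.exists_bound_of_continuousOn (hLam.continuousOn (s := Icc μa μb))
    exact ⟨L, fun μ hμ ↦ by simpa [Real.norm_eq_abs] using hL μ hμ⟩
  set R : ℝ := |omega0 M a m| + (|L| + 1) + (μb ^ 2 + 1) + 1 with hR_def
  have hR : 0 ≤ R := by positivity
  have hμa0 : 0 ≤ μa := (abs_nonneg _).trans hμa.le
  have hbox : ∀ μ ∈ Icc μa μb, thrP M a m (Lam μ) ((μ ^ 2 : ℝ) : ℂ) ∈ horBoxClosed R := by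
    intro μ hμ
    refine horBox_subset_horBoxClosed R (thrP_mem_horBox ?_ ?_ (by positivity) (by positivity))
    · linarith [hL μ hμ, le_abs_self L]
    · rw [abs_of_nonneg (sq_nonneg μ)]
      have : μ ^ 2 ≤ μb ^ 2 := by
        have h1 : 0 ≤ μ := hμa0.trans hμ.1
        nlinarith [hμ.2]
      linarith
  -- `γ² = (μa² − ω₀²)/2`
  have hgap : 0 < μa ^ 2 - omega0 M a m ^ 2 := by
    have : |omega0 M a m| ^ 2 < μa ^ 2 := by
      exact pow_lt_pow_left₀ hμa (abs_nonneg _) two_ne_zero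
    rw [sq_abs] at this; linarith
  set γ : ℝ := Real.sqrt ((μa ^ 2 - omega0 M a m ^ 2) / 2) with hγ
  have hγ0 : 0 < γ := Real.sqrt_pos.2 (by positivity)
  have hγ2 : γ ^ 2 = (μa ^ 2 - omega0 M a m ^ 2) / 2 := Real.sq_sqrt (by positivity)
  set S : ℝ := Kerr.rPlus M a + 1 + radNBound M a m R * (1 + Kerr.rPlus M a) ^ 3 / γ ^ 2 with hS
  have hB : 0 ≤ radNBound M a m R * (1 + Kerr.rPlus M a) ^ 3 := by
    have := radNBound_nonneg (M := M) (a := a) (m := m) hR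
    have := rPlus_pos_of_isSubextremal h
    positivity
  refine ⟨S, γ ^ 2, (μb ^ 2 + omega0 M a m ^ 2) + γ ^ 2, by
    have : 0 ≤ radNBound M a m R * (1 + Kerr.rPlus M a) ^ 3 / γ ^ 2 := by positivity
    simp only [hS]; linarith, by positivity, fun μ hμ t ht ↦ ?_⟩
  set p := thrP M a m (Lam μ) ((μ ^ 2 : ℝ) : ℂ) with hp
  have hre : 2 * γ ^ 2 ≤ (p.2.2 - p.1 ^ 2).re := by
    simp only [hp, thrP_snd_snd, thrP_fst, Complex.sub_re, Complex.ofReal_re, ← Complex.ofReal_pow]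
    have h1 : 0 ≤ μ := hμa0.trans hμ.1
    have : μa ^ 2 ≤ μ ^ 2 := by nlinarith [hμ.1]
    rw [hγ2]; linarith
  obtain ⟨h1, h2⟩ := re_radQ_ge (m := m) h hR (hbox μ hμ) hγ0 hre (r := t) ht
  have hq : thrQ M a m (Lam μ) (μ ^ 2) t = (radQ M a m p t).re := rfl
  refine ⟨by rw [hq]; exact h1, ?_⟩
  rw [hq]
  refine (Complex.abs_re_le_norm _).trans (h2.trans ?_)
  gcongr
  -- `‖σ − ω₀²‖ ≤ μb² + ω₀²`
  simp only [thrP_snd_snd, thrP_fst, ← Complex.ofReal_pow, ← Complex.ofReal_sub, Complex.norm_real, Real.norm_eq_abs]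
  have h1' : 0 ≤ μ := hμa0.trans hμ.1
  have : μ ^ 2 ≤ μb ^ 2 := by nlinarith [hμ.2]
  refine (abs_sub _ _).trans ?_
  rw [abs_of_nonneg (sq_nonneg μ), abs_of_nonneg (sq_nonneg _)]
  linarith

end Family


/-! ### A zero for `μ²` slightly above `ω₀²` (Sturm window far out) -/

section FirstZero

variable {M a : ℝ} {m : ℤ}

/-- **Upper bound for `q` far out.** For `t ≥ A` with `A ≥ 2r₊ + 2`, `A ≥ a²/(2M)`:
`q(t; Λ, σ) ≤ (x t² − 2Mω₀² t + Λ)/Δ` where `x = σ − ω₀²`, and `t²/4 ≤ Δ ≤ t²`. [folklore] -/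
theorem thrQ_le_far (h : Kerr.IsSubextremal M a) (Λ σ : ℝ) {t : ℝ} (ht : 2 * Kerr.rPlus M a + 2 ≤ t)
    (ht' : a ^ 2 / (2 * M) ≤ t) :
    thrQ M a m Λ σ t ≤ ((σ - omega0 M a m ^ 2) * t ^ 2 - 2 * M * omega0 M a m ^ 2 * t + Λ) / Kerr.delta M a t ∧
      t ^ 2 / 4 ≤ Kerr.delta M a t ∧ Kerr.delta M a t ≤ t ^ 2 := by
  have hrp := rPlus_pos_of_isSubextremal h
  have hM := h.pos
  have htr : Kerr.rPlus M a < t := by linarith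
  have hΔ := Kerr.delta_pos h.le htr
  have hΔ1 : t ^ 2 / 4 ≤ Kerr.delta M a t := by
    have := (sq_le_delta h (r := t) (by linarith)).1
    nlinarith
  have hΔ2 : Kerr.delta M a t ≤ t ^ 2 := by
    rw [Kerr.delta]
    have : a ^ 2 ≤ t * (2 * M) := by rwa [div_le_iff₀ (by positivity)] at ht'
    linarith
  refine ⟨?_, hΔ1, hΔ2⟩
  rw [thrQ_eq, thrV_eq h, div_le_div_iff₀ (pow_pos hΔ 2) hΔ]
  have hd : 0 ≤ horD M a ^ 2 / 4 := by positivity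
  have h4 : 0 ≤ 4 * M ^ 2 * omega0 M a m ^ 2 * (t - Kerr.rPlus M a) ^ 2 := by positivity
  nlinarith [mul_nonneg (add_nonneg hd h4) hΔ.le, sq_nonneg (Kerr.delta M a t)]
set_option maxHeartbeats 400000 in -- buildfix (bf3-g27): 160k/180k FAIL, 200k PASS at accept time; line-neutral budget line
/-- **A zero of `z` for `σ` slightly above `ω₀²`.** For `ω₀ ≠ 0` and `|Λ| ≤ L` there are `A > r₊`
and `ε > 0` (depending on `M, a, m, L`) such that for `ω₀² ≤ σ ≤ ω₀² + ε` hmm strictly: for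
`0 ≤ σ − ω₀² ≤ ε`, `z(·; Λ, σ)` vanishes somewhere in `[A, 2A]` (`q ≤ −Mω₀²/(4A)` there; Sturm
window of `HalfLineShooting.exists_zero_of_le_neg_sq`). This is the ODE form of SR's Lemma 4.3.
[cite: ShlapentokhRothman2014KleinGordon, §4.2 Lemma 4.3] -/
theorem exists_zero_thrZ_of_small (h : Kerr.IsSubextremal M a) (hω : omega0 M a m ≠ 0) (L : ℝ) :
    ∃ A ε : ℝ, Kerr.rPlus M a < A ∧ 0 < ε ∧ ∀ Λ σ : ℝ, |Λ| ≤ L → 0 ≤ σ - omega0 M a m ^ 2 →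
      σ - omega0 M a m ^ 2 ≤ ε → ∃ t ∈ Icc A (2 * A), thrZ M a m Λ σ t = 0 := by
  have hrp := rPlus_pos_of_isSubextremal h
  have hM := h.pos
  have hw2 : 0 < M * omega0 M a m ^ 2 := by positivity
  have hL : ∀ {Λ : ℝ}, |Λ| ≤ L → 0 ≤ L := fun hΛ ↦ (abs_nonneg _).trans hΛ
  set A : ℝ := 2 * Kerr.rPlus M a + 2 + a ^ 2 / (2 * M) + 2 * |L| / (M * omega0 M a m ^ 2) +
    41 / (M * omega0 M a m ^ 2) with hA
  have hA1 : 2 * Kerr.rPlus M a + 2 ≤ A := by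
    have : 0 ≤ a ^ 2 / (2 * M) := by positivity
    have : 0 ≤ 2 * |L| / (M * omega0 M a m ^ 2) := by positivity
    have : 0 ≤ 41 / (M * omega0 M a m ^ 2) := by positivity
    linarith
  have hA0 : 0 < A := by linarith
  have hA2 : a ^ 2 / (2 * M) ≤ A := by
    have : 0 ≤ 2 * |L| / (M * omega0 M a m ^ 2) := by positivity
    have : 0 ≤ 41 / (M * omega0 M a m ^ 2) := by positivity
    linarith
  have hA3 : 2 * |L| ≤ M * omega0 M a m ^ 2 * A := by
    have h1 : 2 * |L| / (M * omega0 M a m ^ 2) ≤ A := by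
      have : 0 ≤ a ^ 2 / (2 * M) := by positivity
      have : 0 ≤ 41 / (M * omega0 M a m ^ 2) := by positivity
      linarith
    rw [div_le_iff₀ hw2] at h1
    linarith
  have hA4 : 40 < M * omega0 M a m ^ 2 * A := by
    have h1 : 41 / (M * omega0 M a m ^ 2) ≤ A := by
      have : 0 ≤ a ^ 2 / (2 * M) := by positivity
      have : 0 ≤ 2 * |L| / (M * omega0 M a m ^ 2) := by positivity
      linarith
    rw [div_le_iff₀ hw2] at h1
    linarith
  set ε : ℝ := M * omega0 M a m ^ 2 / (8 * A) with hε
  have hε0 : 0 < ε := by positivity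
  refine ⟨A, ε, by linarith, hε0, fun Λ σ hΛ hx0 hxε ↦ ?_⟩
  set x := σ - omega0 M a m ^ 2 with hx
  -- the Sturm window `[A, 2A]` with `k² = Mω₀²/(4A)`
  set k : ℝ := Real.sqrt (M * omega0 M a m ^ 2 / (4 * A)) with hk
  have hk2 : k ^ 2 = M * omega0 M a m ^ 2 / (4 * A) := Real.sq_sqrt (by positivity)
  have hqk : ∀ s ∈ Icc A (2 * A), thrQ M a m Λ σ s ≤ -k ^ 2 := by
    intro s hs
    obtain ⟨hq, hΔ1, hΔ2⟩ := thrQ_le_far (m := m) h Λ σ (t := s) (by linarith [hs.1]) (by linarith [hs.1])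
    have hsr : Kerr.rPlus M a < s := by linarith [hs.1]
    have hΔ := Kerr.delta_pos h.le hsr
    refine hq.trans ?_
    rw [hk2, div_le_iff₀ hΔ]
    -- `x s² − 2Mω₀² s + Λ ≤ −(Mω₀²/(4A)) Δ`
    have e1 : x * s ^ 2 ≤ M * omega0 M a m ^ 2 / (8 * A) * (2 * A) ^ 2 := by
      have hs2 : s ^ 2 ≤ (2 * A) ^ 2 := by nlinarith [hs.1, hs.2]
      exact mul_le_mul hxε hs2 (sq_nonneg _) (by positivity)
    have e3 : Λ ≤ |L| := (le_abs_self Λ).trans (hΛ.trans (le_abs_self L))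
    have e4 : Kerr.delta M a s ≤ (2 * A) ^ 2 := hΔ2.trans (by nlinarith [hs.1, hs.2])
    have e5 : M * omega0 M a m ^ 2 / (8 * A) * (2 * A) ^ 2 = M * omega0 M a m ^ 2 * A / 2 := by
      field_simp; ring
    rw [e5] at e1
    have e6 : -(M * omega0 M a m ^ 2 / (4 * A)) * Kerr.delta M a s ≥ -(M * omega0 M a m ^ 2 * A) := by
      have : M * omega0 M a m ^ 2 / (4 * A) * Kerr.delta M a s ≤ M * omega0 M a m ^ 2 / (4 * A) * (2 * A) ^ 2 :=
        mul_le_mul_of_nonneg_left e4 (by positivity)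
      have e7 : M * omega0 M a m ^ 2 / (4 * A) * (2 * A) ^ 2 = M * omega0 M a m ^ 2 * A := by field_simp; ring
      linarith
    nlinarith [hs.1, hs.2, hw2]
  have hk10 : 10 < k ^ 2 * (2 * A - A) ^ 2 := by
    rw [hk2]
    have : M * omega0 M a m ^ 2 / (4 * A) * (2 * A - A) ^ 2 = M * omega0 M a m ^ 2 * A / 4 := by
      field_simp; ring
    rw [this]; linarith
  have hsol := isSol2_thrZ (m := m) h Λ σ
  obtain ⟨z, hz, hz0⟩ := exists_zero_of_le_neg_sq (continuousOn_thrQ h.le Λ σ)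
    (fun t ht ↦ ⟨hsol.hasDerivAt t ht, hsol.hasDerivAt_deriv t ht⟩) (by linarith : Kerr.rPlus M a < A)
    (by linarith : A < 2 * A) hqk hk10
  exact ⟨z, hz, hz0⟩

end FirstZero

/-! ### The bound state at threshold (shooting in `μ`) -/

section BoundState

variable {M a : ℝ} {m : ℤ}

/-- **A positive, exponentially decaying real threshold solution** — the ODE form of SR's
Propositions 4.1–4.2 (`μ₀ = sup 𝒜`), by `HalfLineShooting.exists_boundState_of_sup_oscillation`:
for a continuous `Λ(μ)`, `μa > |ω₀|`, if some member of the family `z(·; Λ(μ), μ²)`, `μ ∈ [μa, μb]`,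
has a zero and the last one has none, then some `z(·; Λ(μ₀), μ₀²)` is positive on `(r₊, ∞)`,
eventually non-increasing, and decays exponentially together with its derivative; the far-field
bounds `c ≤ q ≤ K` (uniform in `μ`) are recorded. [cite: ShlapentokhRothman2014KleinGordon, §4.2 Props. 4.1–4.2] -/
theorem exists_threshold_boundState (h : Kerr.IsSubextremal M a) {Lam : ℝ → ℝ} (hLam : Continuous Lam)
    {μa μb : ℝ} (hμa : |omega0 M a m| < μa)
    (hZ : ∃ μ ∈ Icc μa μb, ∃ t ∈ Ioi (Kerr.rPlus M a), thrZ M a m (Lam μ) (μ ^ 2) t = 0)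
    (hb : ∀ t ∈ Ioi (Kerr.rPlus M a), thrZ M a m (Lam μb) (μb ^ 2) t ≠ 0) :
    ∃ μ₀ ∈ Icc μa μb, ∃ S c K : ℝ, Kerr.rPlus M a < S ∧ 0 < c ∧
      (∀ t ∈ Ioi (Kerr.rPlus M a), 0 < thrZ M a m (Lam μ₀) (μ₀ ^ 2) t) ∧
      (∀ t ∈ Ici S, thrZ₁ M a m (Lam μ₀) (μ₀ ^ 2) t ≤ 0) ∧
      (∃ C : ℝ, ∀ t : ℝ, S + 1 ≤ t →
        |thrZ M a m (Lam μ₀) (μ₀ ^ 2) t| ≤ C * Real.exp (-(Real.sqrt c * t)) ∧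
          |thrZ₁ M a m (Lam μ₀) (μ₀ ^ 2) t| ≤ C * Real.exp (-(Real.sqrt c * t))) ∧
      (∀ μ ∈ Icc μa μb, ∀ t ∈ Ici S, c ≤ thrQ M a m (Lam μ) (μ ^ 2) t ∧ |thrQ M a m (Lam μ) (μ ^ 2) t| ≤ K) := by
  have hμa0 : 0 ≤ μa := (abs_nonneg _).trans hμa.le
  obtain ⟨S, c, K, hS, hc, hQc⟩ := exists_thrQ_ge_uniform (m := m) h hLam (μb := μb) hμa
  obtain ⟨r₁, hr₁, hpos⟩ := exists_thrZ_pos_near_uniform (m := m) h hLam (μb := μb) hμa0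
  obtain ⟨hv, hv'⟩ := continuousOn_thrZ_family (m := m) h hLam (Icc μa μb)
  obtain ⟨μ₀, hμ₀, hpos₀, hder₀, hdec₀⟩ := exists_boundState_of_sup_oscillation
    (Q := fun μ t ↦ thrQ M a m (Lam μ) (μ ^ 2) t) (v := fun μ t ↦ thrZ M a m (Lam μ) (μ ^ 2) t)
    (v' := fun μ t ↦ thrZ₁ M a m (Lam μ) (μ ^ 2) t)
    (fun μ _ ↦ continuousOn_thrQ h.le _ _)
    (fun μ _ t ht ↦ ⟨(isSol2_thrZ (m := m) h _ _).hasDerivAt t ht, (isSol2_thrZ (m := m) h _ _).hasDerivAt_deriv t ht⟩)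
    hv hv' hr₁ hpos hS hc (fun μ hμ t ht ↦ (hQc μ hμ t ht).1) hZ hb
  exact ⟨μ₀, hμ₀, S, c, K, hS, hc, hpos₀, hder₀, hdec₀, hQc⟩

/-- Positivity everywhere from "no zeros": a member of the family without zeros is positive on
`(r₊, ∞)` (it is positive near `r₊`; intermediate values). [folklore] -/
theorem thrZ_pos_of_ne_zero (h : Kerr.IsSubextremal M a) {Λ σ : ℝ}
    (hne : ∀ t ∈ Ioi (Kerr.rPlus M a), thrZ M a m Λ σ t ≠ 0) : ∀ t ∈ Ioi (Kerr.rPlus M a), 0 < thrZ M a m Λ σ t := by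
  obtain ⟨r₁, hr₁, hpos⟩ := exists_thrZ_pos_near (m := m) h Λ σ
  intro t ht
  by_contra hle
  push Not at hle
  have hlt : thrZ M a m Λ σ t < 0 := lt_of_le_of_ne hle (hne t ht)
  rcases le_or_gt t r₁ with h1 | h1
  · exact absurd (hpos t ⟨ht, h1⟩) (not_lt.2 hle)
  · have hcont : ContinuousOn (thrZ M a m Λ σ) (Icc r₁ t) :=
      (isSol2_thrZ (m := m) h Λ σ).continuousOn.1.mono fun s hs ↦ lt_of_lt_of_le hr₁ hs.1
    have hmem : (0 : ℝ) ∈ Icc (thrZ M a m Λ σ t) (thrZ M a m Λ σ r₁) := ⟨hlt.le, (hpos r₁ ⟨hr₁, le_rfl⟩).le⟩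
    obtain ⟨s, hs, hs0⟩ := intermediate_value_Icc' h1.le hcont hmem
    exact hne s (lt_of_lt_of_le hr₁ hs.1) hs0

/-- **Sturm comparison at threshold**: if `z(·; Λ₀, σ₀)` is positive on `(r₊, ∞)` and decays
exponentially with its derivative, then every `z(·; Λ, σ)` with `Λ ≤ Λ₀`, `σ < σ₀`, `σ > ω₀²`
has a zero. (The Wronskian `W = z z₀' − z' z₀` vanishes at `r₊`, has `W' = (q₀ − q) z z₀ > 0` while
`z > 0`, so `z₀/z` increases and `z` decays too, forcing `W → 0` at infinity — impossible for a
positive increasing function.) [cite: Hartman2002, Ch. XI §6; ShlapentokhRothman2014KleinGordon, §4.2] -/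
theorem exists_zero_of_lt (h : Kerr.IsSubextremal M a) {Λ Λ₀ σ σ₀ : ℝ} (hΛ : Λ ≤ Λ₀) (hσ : σ < σ₀)
    (hσω : omega0 M a m ^ 2 < σ)
    (hpos₀ : ∀ t ∈ Ioi (Kerr.rPlus M a), 0 < thrZ M a m Λ₀ σ₀ t)
    (hdec₀ : ∃ S C κ : ℝ, 0 < κ ∧ ∀ t : ℝ, S ≤ t →
      |thrZ M a m Λ₀ σ₀ t| ≤ C * Real.exp (-(κ * t)) ∧ |thrZ₁ M a m Λ₀ σ₀ t| ≤ C * Real.exp (-(κ * t))) :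
    ∃ t ∈ Ioi (Kerr.rPlus M a), thrZ M a m Λ σ t = 0 := by
  have hrp := rPlus_pos_of_isSubextremal h
  by_contra hno
  push Not at hno
  have hpos : ∀ t ∈ Ioi (Kerr.rPlus M a), 0 < thrZ M a m Λ σ t := thrZ_pos_of_ne_zero (m := m) h hno
  have hz := isSol2_thrZ (m := m) h Λ σ
  have hz₀ := isSol2_thrZ (m := m) h Λ₀ σ₀
  -- far-field bounds for `q(·; Λ, σ)` via the family with constant `Lam`
  have hμa : |omega0 M a m| < Real.sqrt σ := by
    rw [← Real.sqrt_sq_eq_abs]; exact Real.sqrt_lt_sqrt (sq_nonneg _) hσω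
  obtain ⟨S', c', K, hS', hc', hQ'⟩ := exists_thrQ_ge_uniform (m := m) h (Lam := fun _ ↦ Λ) continuous_const
    (μa := Real.sqrt σ) (μb := Real.sqrt σ) hμa
  have hσ0 : 0 ≤ σ := ((sq_nonneg _).trans_lt hσω).le
  have hKq : ∀ t ∈ Ici S', |thrQ M a m Λ σ t| ≤ K := by
    intro t ht
    have := (hQ' (Real.sqrt σ) ⟨le_rfl, le_rfl⟩ t ht).2
    rwa [Real.sq_sqrt hσ0] at this
  have hK0 : 0 ≤ K := (abs_nonneg _).trans (hKq S' (mem_Ici.2 le_rfl))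
  obtain ⟨S, C, κ, hκ, hdec⟩ := hdec₀
  -- the Wronskian
  set W : ℝ → ℝ := wronskian (thrZ M a m Λ σ) (thrZ₁ M a m Λ σ) (thrZ M a m Λ₀ σ₀) (thrZ₁ M a m Λ₀ σ₀) with hW
  have hWd : ∀ t ∈ Ioi (Kerr.rPlus M a), HasDerivAt W
      ((thrQ M a m Λ₀ σ₀ t - thrQ M a m Λ σ t) * thrZ M a m Λ σ t * thrZ M a m Λ₀ σ₀ t) t :=
    fun t ht ↦ hasDerivAt_wronskian₂ hz hz₀ ht
  have hWpos' : ∀ t ∈ Ioi (Kerr.rPlus M a), 0 < (thrQ M a m Λ₀ σ₀ t - thrQ M a m Λ σ t) *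
      thrZ M a m Λ σ t * thrZ M a m Λ₀ σ₀ t := fun t ht ↦
    mul_pos (mul_pos (sub_pos.2 (thrQ_lt_thrQ (m := m) h hΛ hσ ht)) (hpos t ht)) (hpos₀ t ht)
  have hWc : ContinuousOn W (Ioi (Kerr.rPlus M a)) := fun t ht ↦ (hWd t ht).continuousAt.continuousWithinAt
  have hWmono : StrictMonoOn W (Ioi (Kerr.rPlus M a)) := by
    refine strictMonoOn_of_deriv_pos (convex_Ioi _) hWc fun t ht ↦ ?_
    rw [interior_Ioi] at ht
    rw [(hWd t ht).deriv]
    exact hWpos' t ht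
  -- `W → 0` at `r₊`, through the complex Wronskian
  have hWlim : Tendsto W (𝓝[>] Kerr.rPlus M a) (𝓝 0) := by
    set p := thrP M a m (Λ : ℂ) (σ : ℂ)
    set q := thrP M a m (Λ₀ : ℂ) (σ₀ : ℂ)
    have hcx := tendsto_wronskian_radY (m := m) h (p := p) (q := q) rfl (by simp [p, thrP])
    rw [tendsto_zero_iff_norm_tendsto_zero] at hcx ⊢
    refine hcx.congr' ?_
    filter_upwards [self_mem_nhdsWithin] with t ht
    obtain ⟨e0, e1⟩ := thrZ_ofReal (m := m) h Λ σ ht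
    obtain ⟨f0, f1⟩ := thrZ_ofReal (m := m) h Λ₀ σ₀ ht
    have : ((W t : ℝ) : ℂ) = conj (thrPhase0 M a m) ^ 2 *
        wronskian (radY M a m p) (radY₁ M a m p) (radY M a m q) (radY₁ M a m q) t := by
      simp only [hW, wronskian]
      push_cast
      rw [e0, e1, f0, f1]
      ring
    rw [show ‖W t‖ = ‖((W t : ℝ) : ℂ)‖ from (Complex.norm_real _).symm, this, norm_mul, norm_pow, Complex.norm_conj,
      norm_thrPhase0]
    simp
  -- hence `W > 0` on `(r₊, ∞)`
  have hWnn : ∀ t ∈ Ioi (Kerr.rPlus M a), 0 ≤ W t := by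
    intro t ht
    have hev : ∀ᶠ s in 𝓝[>] Kerr.rPlus M a, W s ≤ W t := by
      filter_upwards [Ioo_mem_nhdsGT ht] with s hs using (hWmono hs.1 ht hs.2).le
    exact le_of_tendsto hWlim hev
  have hWpos : ∀ t ∈ Ioi (Kerr.rPlus M a), 0 < W t := by
    intro t ht
    set s := (Kerr.rPlus M a + t) / 2
    have hs : Kerr.rPlus M a < s := by simp only [s]; linarith [mem_Ioi.1 ht]
    have hst : s < t := by simp only [s]; linarith [mem_Ioi.1 ht]
    exact (hWnn s hs).trans_lt (hWmono hs ht hst)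
  -- the ratio `z₀/z` is non-decreasing
  set g : ℝ → ℝ := fun t ↦ thrZ M a m Λ₀ σ₀ t / thrZ M a m Λ σ t with hg
  have hgd : ∀ t ∈ Ioi (Kerr.rPlus M a), HasDerivAt g (W t / thrZ M a m Λ σ t ^ 2) t := by
    intro t ht
    have h1 := (hz₀.hasDerivAt t ht).div (hz.hasDerivAt t ht) (hpos t ht).ne'
    refine h1.congr_deriv ?_
    simp only [hW, wronskian]; ring
  have hgmono : MonotoneOn g (Ioi (Kerr.rPlus M a)) := by
    refine monotoneOn_of_deriv_nonneg (convex_Ioi _) (fun t ht ↦ (hgd t ht).continuousAt.continuousWithinAt)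
      (fun t ht ↦ ?_) fun t ht ↦ ?_
    · rw [interior_Ioi] at ht; exact (hgd t ht).differentiableAt.differentiableWithinAt
    · rw [interior_Ioi] at ht
      rw [(hgd t ht).deriv]
      exact div_nonneg (hWpos t ht).le (sq_nonneg _)
  -- a base point beyond all thresholds
  set T₀ : ℝ := max (max S S') (Kerr.rPlus M a + 1) with hT₀
  have hT₀r : Kerr.rPlus M a < T₀ := by
    have := le_max_right (max S S') (Kerr.rPlus M a + 1); linarith
  have hT₀S : S ≤ T₀ := (le_max_left _ _).trans (le_max_left _ _)
  have hT₀S' : S' ≤ T₀ := (le_max_right _ _).trans (le_max_left _ _)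
  have hT₀0 : 0 ≤ T₀ := by linarith
  set κ₀ := g T₀ with hκ₀
  have hκ₀pos : 0 < κ₀ := div_pos (hpos₀ T₀ hT₀r) (hpos T₀ hT₀r)
  -- `z ≤ z₀/κ₀ ≤ C/κ₀ e^{−κ t}` beyond `T₀`
  have hzle : ∀ t, T₀ ≤ t → thrZ M a m Λ σ t ≤ C / κ₀ * Real.exp (-(κ * t)) := by
    intro t ht
    have htr : t ∈ Ioi (Kerr.rPlus M a) := lt_of_lt_of_le hT₀r ht
    have hgt : κ₀ ≤ g t := hgmono hT₀r htr ht
    have hzp := hpos t htr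
    have h1 : κ₀ * thrZ M a m Λ σ t ≤ thrZ M a m Λ₀ σ₀ t := by
      have := (le_div_iff₀ hzp).1 hgt; linarith
    have h2 : thrZ M a m Λ₀ σ₀ t ≤ C * Real.exp (-(κ * t)) := (le_abs_self _).trans (hdec t (hT₀S.trans ht)).1
    rw [div_mul_eq_mul_div, le_div_iff₀ hκ₀pos]
    linarith
  have hC0 : 0 ≤ C := by
    have h1 := (abs_nonneg _).trans (hdec T₀ hT₀S).1
    have h2 : 0 < Real.exp (-(κ * T₀)) := Real.exp_pos _
    nlinarith
  set Mb : ℝ := C / κ₀ with hMb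
  have hMb0 : 0 ≤ Mb := div_nonneg hC0 hκ₀pos.le
  have hzb : ∀ t, T₀ ≤ t → |thrZ M a m Λ σ t| ≤ Mb := by
    intro t ht
    have htr : t ∈ Ioi (Kerr.rPlus M a) := lt_of_lt_of_le hT₀r ht
    rw [abs_of_pos (hpos t htr)]
    refine (hzle t ht).trans ?_
    have : Real.exp (-(κ * t)) ≤ 1 := by
      rw [Real.exp_le_one_iff]; nlinarith [hT₀0.trans ht]
    exact (mul_le_of_le_one_right hMb0 this)
  have hz₁b : ∀ t, T₀ ≤ t → |thrZ₁ M a m Λ σ t| ≤ (2 + K) * Mb := by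
    intro t ht
    have := hz.norm_deriv_le_of_bound (t := t) (K := K) (M := Mb)
      (fun s hs ↦ lt_of_lt_of_le hT₀r (ht.trans hs.1))
      (fun s hs ↦ by rw [Real.norm_eq_abs]; exact hKq s (hT₀S'.trans (ht.trans hs.1)))
      (fun s hs ↦ by rw [Real.norm_eq_abs]; exact hzb s (ht.trans hs.1))
    rwa [Real.norm_eq_abs] at this
  -- `|W t| ≤ (3 + K) Mb C e^{−κ t}` beyond `T₀`
  have hWle : ∀ t, T₀ ≤ t → W t ≤ (3 + K) * Mb * C * Real.exp (-(κ * t)) := by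
    intro t ht
    have htr : t ∈ Ioi (Kerr.rPlus M a) := lt_of_lt_of_le hT₀r ht
    obtain ⟨d0, d1⟩ := hdec t (hT₀S.trans ht)
    have hzt := hzb t ht
    have hz₁t := hz₁b t ht
    have hE : 0 ≤ Real.exp (-(κ * t)) := (Real.exp_pos _).le
    simp only [hW, wronskian]
    have h1 : thrZ M a m Λ σ t * thrZ₁ M a m Λ₀ σ₀ t ≤ Mb * (C * Real.exp (-(κ * t))) := by
      refine (le_abs_self _).trans ?_
      rw [abs_mul]
      exact mul_le_mul hzt d1 (abs_nonneg _) hMb0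
    have h2 : -(thrZ₁ M a m Λ σ t * thrZ M a m Λ₀ σ₀ t) ≤ (2 + K) * Mb * (C * Real.exp (-(κ * t))) := by
      refine (neg_le_abs _).trans ?_
      rw [abs_mul]
      exact mul_le_mul hz₁t d0 (abs_nonneg _) (by positivity)
    nlinarith
  -- contradiction: `W ≥ W T₀ > 0` but the bound tends to `0`
  have hlim : Tendsto (fun t ↦ (3 + K) * Mb * C * Real.exp (-(κ * t))) atTop (𝓝 0) := by
    have h1 : Tendsto (fun t ↦ Real.exp (-(κ * t))) atTop (𝓝 0) := by
      have := Real.tendsto_exp_neg_atTop_nhds_zero.comp (tendsto_id.const_mul_atTop hκ)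
      simpa [Function.comp_def] using this
    simpa using h1.const_mul ((3 + K) * Mb * C)
  have hev := (hlim.eventually (gt_mem_nhds (hWpos T₀ hT₀r))).and (eventually_ge_atTop T₀)
  obtain ⟨t, ht1, ht2⟩ := hev.exists
  have htr : t ∈ Ioi (Kerr.rPlus M a) := lt_of_lt_of_le hT₀r ht2
  have hWt : W T₀ ≤ W t := hWmono.monotoneOn hT₀r htr ht2
  linarith [hWle t ht2]

/-- **Zeros escape to infinity near the bound state**: if `z(·; Λ(μ₀), μ₀²) > 0` on `(r₊, ∞)`,
then for every `T` and all `μ ∈ [μa, μb]` close to `μ₀`, `z(·; Λ(μ), μ²) > 0` on `(r₊, T]`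
(uniform positivity near `r₊` and uniform convergence on `[r₁, T]`). [folklore] -/
theorem eventually_thrZ_pos_on_Ioc (h : Kerr.IsSubextremal M a) {Lam : ℝ → ℝ} (hLam : Continuous Lam)
    {μa μb μ₀ : ℝ} (hμa : 0 ≤ μa) (hpos₀ : ∀ t ∈ Ioi (Kerr.rPlus M a), 0 < thrZ M a m (Lam μ₀) (μ₀ ^ 2) t)
    (T : ℝ) :
    ∀ᶠ μ in 𝓝 μ₀, μ ∈ Icc μa μb → ∀ t ∈ Ioc (Kerr.rPlus M a) T, 0 < thrZ M a m (Lam μ) (μ ^ 2) t := by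
  obtain ⟨r₁, hr₁, hpos⟩ := exists_thrZ_pos_near_uniform (m := m) h hLam (μb := μb) hμa
  rcases le_or_gt T r₁ with hT | hT
  · exact Eventually.of_forall fun μ hμ t ht ↦ hpos μ hμ t ⟨ht.1, ht.2.trans hT⟩
  -- minimum of `z(·; μ₀)` on `[r₁, T]`
  have hcont : ContinuousOn (thrZ M a m (Lam μ₀) (μ₀ ^ 2)) (Icc r₁ T) :=
    (isSol2_thrZ (m := m) h _ _).continuousOn.1.mono fun s hs ↦ lt_of_lt_of_le hr₁ hs.1
  obtain ⟨s₀, hs₀, hmin⟩ := isCompact_Icc.exists_isMinOn (nonempty_Icc.2 hT.le) hcont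
  set m₀ := thrZ M a m (Lam μ₀) (μ₀ ^ 2) s₀ with hm₀
  have hm₀pos : 0 < m₀ := hpos₀ s₀ (lt_of_lt_of_le hr₁ hs₀.1)
  have hU := tendstoUniformlyOn_thrZ_family (m := m) h hLam μ₀ T hr₁
  have hev := (Metric.tendstoUniformlyOn_iff.1 hU) (m₀ / 2) (half_pos hm₀pos)
  filter_upwards [hev] with μ hμ hμI t ht
  rcases le_or_gt t r₁ with h1 | h1
  · exact hpos μ hμI t ⟨ht.1, h1⟩
  · have htI : t ∈ Icc r₁ T := ⟨h1.le, ht.2⟩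
    have hd := hμ t htI
    rw [Prod.dist_eq, max_lt_iff] at hd
    have hd1 := hd.1
    rw [Real.dist_eq] at hd1
    have hmt : m₀ ≤ thrZ M a m (Lam μ₀) (μ₀ ^ 2) t := hmin htI
    have := (abs_lt.1 hd1).2
    linarith

end BoundState

end Literature.Barriers.FinalStateConjecture
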